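import Literature.Barriers.QuantumAdvantage.AaronsonChenAdviceMaps
import Literature.Barriers.QuantumAdvantage.AaronsonChenAdviceWeights
import Literature.Barriers.QuantumAdvantage.TQBFMembership
import Literature.Computability.Complexity.CHSums
import Literature.Computability.Complexity.FoldBricks
import Literature.Computability.Complexity.GapNatPSpace
import Literature.Computability.QuantumComplexity.AaronsonAmbainisThm23Atoms
import Literature.Computability.QuantumComplexity.GuessedAnnRuns
import HarnessLib

/-!
# Aaronson–Chen 2017, Lemma 5.3: the two physical predicates of the `SampBPP^{TQBF,O}` simulator are in `PSPACE`

Machine-level discharge of the printed sentence "it is not hard to see that all the computations can be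
done in `PSPACE`" ([AaronsonChen2017, §5.3 p. 23]) in the form consumed by the assembly of Lemma 5.3
(`AaronsonChenAdvicePSPACE.lean`: `aaronsonChen2017_lem53_of_physics`): for protocol data with a
UNIFORM Clifford+T query-circuit family and bounding polynomials, the heavy/small-table predicate
`AcProto.HeavyLang` and the cumulative-distribution predicate `AcProto.CdfLang`
(`AaronsonChenAdvice.lean`) are in `PSPACE` — **`AcProto.HeavyLang_mem_PSPACE`**,
**`AcProto.CdfLang_mem_PSPACE`**, **`AcProto.physics_mem_PSPACE`**.

The line of proof (four parts, each with its own summary below):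

1. `AaronsonChenTabLang` — the learned tables `tabsOf x₀ r h t` read off the history are a `PSPACE`
   (indeed bounded-`∃` over `P`) predicate `TabLang` (`mem_TabLang_iff`);
2. `AaronsonChenWalkAtoms` — the guessed total walk of the replaced circuit (the Aaronson–Ambainis
   walk machine `ADHOracleWalk.lean` / `AaronsonAmbainisThm23Atoms.lean` of the tree), its prefix
   atoms, the answer language `JLang` (`TQBF ⊕ table`, using the tree's `TQBF_mem_PSPACE`) and the
   CONSISTENCY of the guessed answer bits as a `PSPACE` predicate `ConsLang` (`mem_ConsLang_iff`,
   against `ADH.ConsG` of `GuessedAnnRuns.lean`);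
3. `AaronsonChenPairSums` — the Hadamard power, the query count, the budget, and the path-PAIR COUNTS
   `annSetA`/`annSetB` of the annotated replaced prefix (`AaronsonChenAdviceWeights.lean`) as
   functions of the instance in Ladner's gap class `GapNatPSPACE` (`GapNatPSpace.lean`), with their
   values (`AZ_BZ_apply`, via `annSetA_eq_sum_consG`);
4. `AaronsonChenPhysicsPSPACE` — the exact `√2`-sign test of two gap functions is a `PSPACE`
   predicate, whence `HeavyLang`, `CdfLang ∈ PSPACE` through `mem_stageList_iff_linFormTest` /
   `sel_iff_linFormTest` (`AaronsonChenAdviceWeights.lean`).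

No named facts are introduced (net debt 0); every definition is an explicit string function, language
or integer function with its semantics proved.

## References

* [AaronsonChen2017] S. Aaronson, L. Chen, CCC 2017 (arXiv:1612.05903), Lemma 5.3, §5.3 (pp. 22–23:
  "Construction and Analysis of g"; "Analysis of the final circuit"; "all the computations can be done
  in PSPACE"), read via `lit read arxiv:1612.05903 --pages 19-25`.
* [AaronsonAmbainis2014] proof of Thm. 23 (p. 14: walking guessed paths in polynomial time).
* [AdlemanDeMarraisHuang1997] §6, Lemma 6.10 (pairs of paths; the normalisation `2^h`).
* [FennerFortnowKurtz1994] §3 (closure of gap classes), Prop. 4.2 (thresholds); [Ladner1989] §1 (`♮PSPACE`).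
* [AroraBarakCC2009] §1.3, Thm. 4.2/§4.1–4.2 (closure of `PSPACE`), Thm. 4.13 (first half, `TQBF ∈ PSPACE`).
-/

/-! ## Part 1 (`AaronsonChenTabLang`): Aaronson–Chen 2017, Lemma 5.3: the learned tables of the simulator are a polynomial-time predicate

Machine-level support for the `PSPACE` membership of the two physical predicates `HeavyLang`/`CdfLang`
of the simulator's advice language (`AaronsonChenAdvice.lean`; the printed "all the computations can
be done in `PSPACE`", [AaronsonChen2017, §5.3 p. 23]). Both predicates evaluate the REPLACED circuit,
whose `t`-th query gate answers `TQBF ⊕ (tabsOf x₀ r h t)` — the table of the strings of `O` learned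
so far, READ OFF THE HISTORY `h` of one-bit answers (`AcProto.tabsOf`, `AaronsonChenProtocol.lean`:
"the decoded payloads of the complete, real blocks of stages `n ≤ t` whose `O`-answer was `1`").
A polynomial-space machine that guesses the answer bits of the query gates must be able to check a
guess against this table, i.e. decide

  `TabLang = {⟨⟨w, h⟩, ⟨τ, v⟩⟩ | v ∈ tabsOf x₀ r h |τ|}`,   `w = ⟨x₀, r⟩`.

This file proves `TabLang ∈ PSPACE` (indeed a polynomially bounded `∃ (n, s)` over a `P` test), in
the brick algebra (`BrickAlgebra.lean`, `PlumbingBricks.lean`, `StackBricksArith.lean`: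
`pairFn`, `polyFn`, `divModFn`, `takeFn`/`dropFn`, `binToUnaryFn`, `lenBinF`/`addFn`/`prodFn`) and
the class-level closure of `PSpaceClosure.lean`:

* accessors and schedule numerals on the witnessed instance `q = ⟨x, y⟩`, `y = ⟨1ⁿ, 1ˢ⟩`; the binary
  slot end `binE0/binE1` (`⟦(n·S + s)·W⟧`, `⟦(n·S + s + 1)·W⟧`), their unary forms `U0/U1` (capped
  conversion against the ruler `1^{learnLen}`), the block `blockF = ((evens h) ⇂ E₀) ↾ W` and its
  decoding; their values (`…_apply`, under `n < Gm`, `s < Sm` where a cap is involved);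
* the seven conditions of `tabsOf` as `P` languages `C1 … C7` and their conjunction `TabRel ∈ P`
  (`mem_TabRel_iff`);
* `TabLang` (the bounded `∃`), **`TabLang_mem_PSPACE`**, and **`mem_TabLang_iff`**:
  `⟨⟨w, h⟩, ⟨τ, v⟩⟩ ∈ TabLang ↔ v ∈ tabsOf x₀ r h |τ|`.

No named facts.

## References

* [AaronsonChen2017] arXiv:1612.05903, §5.3 (pp. 22–23: "g(x) = f_known(x)"; "all the computations
  can be done in PSPACE"), read via `lit read arxiv:1612.05903 --pages 19-25`.
* [AroraBarakCC2009] §1.3 (polynomial time is closed under composition), Thm. 4.2/§4.1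
  (`NP ⊆ PSPACE`: bounded `∃` by reusing space), as `polyExists_mem_PSPACE`.
-/

noncomputable section

namespace Literature.Barriers.QuantumAdvantage

open MeasureTheory _root_.Computability Polynomial Literature.Computability.Complexity
  Literature.Computability.Complexity.Brick Literature.Computability.Complexity.Plumb
  Literature.Computability.Complexity.OracleCompose Literature.Computability.Complexity.PRelSigma
  Literature.Computability.Complexity.TTClosure Literature.Computability.Complexity.StrEq
  Literature.Computability.Cryptography

namespace AcProto

variable (P : AcProto)

/-! ### Accessors on the witnessed instance `q = ⟨⟨⟨w, h⟩, ⟨τ, v⟩⟩, ⟨1ⁿ, 1ˢ⟩⟩` -/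

section Accessors

/-- The advice-shaped part `⟨w, h⟩`. [folklore] -/
abbrev zQ : List Bool → List Bool := fstP ∘ fstP
/-- The history `h`. [folklore] -/
abbrev hQ : List Bool → List Bool := sndP ∘ fstP ∘ fstP
/-- The stage numeral `τ` (stage `|τ|`). [folklore] -/
abbrev tauQ : List Bool → List Bool := fstP ∘ sndP ∘ fstP
/-- The candidate string `v`. [folklore] -/
abbrev vQ : List Bool → List Bool := sndP ∘ sndP ∘ fstP
/-- The witness component `1ⁿ` (any string; `n` is its length). [folklore] -/
abbrev nQ : List Bool → List Bool := fstP ∘ sndP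
/-- The witness component `1ˢ`. [folklore] -/
abbrev sQ : List Bool → List Bool := sndP ∘ sndP
/-- The re-paired game input `⟨x₀, r⟩` (length `wl`). [folklore] -/
def wQ : List Bool → List Bool := repZ ∘ zQ

/-- `wQ ∈ FP`. [folklore] -/
theorem wQ_mem_FP : wQ ∈ FP := comp_mem_FP repZ_mem_FP (comp_mem_FP fstP_mem_FP fstP_mem_FP)

end Accessors

/-- The schedule length `wl x₀ r` read off `q`. [folklore] -/
def mQ (q : List Bool) : ℕ := mmOf (zQ q)

/-- `|wQ q| = mQ q`. [folklore] -/
theorem length_wQ (q : List Bool) : (wQ q).length = mQ q := length_repZ _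

/-! ### The slot arithmetic -/

/-- `⟦n·S + s⟧` in binary (`n = |1ⁿ|`, `s = |1ˢ|`, `S = Sm(wl)`). [folklore] -/
def binNS : List Bool → List Bool :=
  addFn ∘ pairFn (prodFn ∘ pairFn (lenBinF ∘ nQ) (lenBinF ∘ polyFn P.SmP ∘ wQ)) (lenBinF ∘ sQ)

/-- `⟦(n·S + s)·W⟧` in binary. [folklore] -/
def binE0 : List Bool → List Bool := prodFn ∘ pairFn P.binNS (lenBinF ∘ polyFn P.WdP ∘ wQ)

/-- `⟦(n·S + s + 1)·W⟧ = ⟦(n·S + s)·W⟧ + W` in binary. [folklore] -/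
def binE1 : List Bool → List Bool := addFn ∘ pairFn P.binE0 (lenBinF ∘ polyFn P.WdP ∘ wQ)

/-- The ruler `1^{learnLen(wl)}` capping the unary conversions. [folklore] -/
def rulerQ : List Bool → List Bool := polyFn P.learnLenP ∘ wQ

/-- `1^{min(E₀, learnLen)}`. [folklore] -/
def U0 : List Bool → List Bool := binToUnaryFn ∘ pairFn P.rulerQ P.binE0

/-- `1^{min(E₁, learnLen)}`. [folklore] -/
def U1 : List Bool → List Bool := binToUnaryFn ∘ pairFn P.rulerQ P.binE1

/-- The block `((evens h) ⇂ |U0|) ↾ W`. [folklore] -/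
def blockF : List Bool → List Bool :=
  takeFn ∘ pairFn (polyFn P.WdP ∘ wQ) (dropFn ∘ pairFn P.U0 (evensT.eval ∘ hQ))

/-- `1^{⌊|h|/2⌋}`. [folklore] -/
def halfH : List Bool → List Bool := fstP ∘ divModFn ∘ pairFn (fun _ => ones 2) (onesFn ∘ hQ)

/-- The position `1^{2|U1| − 1}` of the `O`-answer closing the slot. [folklore] -/
def posF : List Bool → List Bool := List.tail ∘ concatFn ∘ pairFn P.U1 P.U1

/-- `binNS ∈ FP`. [folklore] -/
theorem binNS_mem_FP : P.binNS ∈ FP :=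
  comp_mem_FP addFn_mem_FP (pairFn_mem_FP (comp_mem_FP prodFn_mem_FP (pairFn_mem_FP (comp_mem_FP lenBinF_mem_FP
    (comp_mem_FP fstP_mem_FP sndP_mem_FP)) (comp_mem_FP lenBinF_mem_FP (comp_mem_FP (polyFn_mem_FP _) wQ_mem_FP))))
    (comp_mem_FP lenBinF_mem_FP (comp_mem_FP sndP_mem_FP sndP_mem_FP)))

/-- `binE0 ∈ FP`. [folklore] -/
theorem binE0_mem_FP : P.binE0 ∈ FP :=
  comp_mem_FP prodFn_mem_FP (pairFn_mem_FP P.binNS_mem_FP (comp_mem_FP lenBinF_mem_FP (comp_mem_FP (polyFn_mem_FP _) wQ_mem_FP)))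

/-- `binE1 ∈ FP`. [folklore] -/
theorem binE1_mem_FP : P.binE1 ∈ FP :=
  comp_mem_FP addFn_mem_FP (pairFn_mem_FP P.binE0_mem_FP (comp_mem_FP lenBinF_mem_FP (comp_mem_FP (polyFn_mem_FP _) wQ_mem_FP)))

/-- `rulerQ ∈ FP`. [folklore] -/
theorem rulerQ_mem_FP : P.rulerQ ∈ FP := comp_mem_FP (polyFn_mem_FP _) wQ_mem_FP

/-- `U0 ∈ FP`. [folklore] -/
theorem U0_mem_FP : P.U0 ∈ FP := comp_mem_FP binToUnaryFn_mem_FP (pairFn_mem_FP P.rulerQ_mem_FP P.binE0_mem_FP)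

/-- `U1 ∈ FP`. [folklore] -/
theorem U1_mem_FP : P.U1 ∈ FP := comp_mem_FP binToUnaryFn_mem_FP (pairFn_mem_FP P.rulerQ_mem_FP P.binE1_mem_FP)

/-- `hQ ∈ FP`. [folklore] -/
theorem hQ_mem_FP : hQ ∈ FP := comp_mem_FP sndP_mem_FP (comp_mem_FP fstP_mem_FP fstP_mem_FP)

/-- `blockF ∈ FP`. [folklore] -/
theorem blockF_mem_FP : P.blockF ∈ FP :=
  comp_mem_FP takeFn_mem_FP (pairFn_mem_FP (comp_mem_FP (polyFn_mem_FP _) wQ_mem_FP)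
    (comp_mem_FP dropFn_mem_FP (pairFn_mem_FP P.U0_mem_FP (comp_mem_FP evensT.polyTimeComputable_eval hQ_mem_FP))))

/-- `halfH ∈ FP`. [folklore] -/
theorem halfH_mem_FP : halfH ∈ FP :=
  comp_mem_FP fstP_mem_FP (comp_mem_FP divModFn_mem_FP (pairFn_mem_FP (const_mem_FP _) (comp_mem_FP onesFn_mem_FP hQ_mem_FP)))

/-- `posF ∈ FP`. [folklore] -/
theorem posF_mem_FP : P.posF ∈ FP :=
  comp_mem_FP tail_mem_FP (comp_mem_FP concatFn_mem_FP (pairFn_mem_FP P.U1_mem_FP P.U1_mem_FP))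

/-! ### Values -/

section Values

variable (q : List Bool)

/-- The stage count read off `q`. [folklore] -/
abbrev nOf : ℕ := (nQ q).length
/-- The slot read off `q`. [folklore] -/
abbrev sOf : ℕ := (sQ q).length
/-- The slot start `E₀ = (n·S + s)·W`. [folklore] -/
def E0 : ℕ := (nOf q * P.Sm (mQ q) + sOf q) * P.Wd (mQ q)
/-- The slot end `E₁ = (n·S + s + 1)·W`. [folklore] -/
def E1 : ℕ := (nOf q * P.Sm (mQ q) + sOf q + 1) * P.Wd (mQ q)

/-- Value of `binNS`. [folklore] -/
theorem binNS_apply : P.binNS q = encodeNat (nOf q * P.Sm (mQ q) + sOf q) := by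
  simp [binNS, length_wQ]
  rfl

/-- Value of `binE0`. [folklore] -/
theorem binE0_apply : P.binE0 q = encodeNat (P.E0 q) := by
  simp [binE0, binNS_apply, length_wQ, E0]

/-- Value of `binE1`. [folklore] -/
theorem binE1_apply : P.binE1 q = encodeNat (P.E1 q) := by
  simp [binE1, binE0_apply, length_wQ, E1, E0]
  ring

/-- Value of `rulerQ`. [folklore] -/
theorem rulerQ_apply : P.rulerQ q = ones (P.learnLen (mQ q)) := by
  simp [rulerQ, length_wQ]

/-- `E₀ < E₁ ≤ learnLen` for `n < Gm`, `s < Sm`. [folklore] -/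
theorem E1_le_learnLen (hn : nOf q < P.Gm (mQ q)) (hs : sOf q < P.Sm (mQ q)) : P.E1 q ≤ P.learnLen (mQ q) := by
  unfold E1 learnLen
  have h1 : nOf q * P.Sm (mQ q) + sOf q + 1 ≤ P.Gm (mQ q) * P.Sm (mQ q) := by
    calc nOf q * P.Sm (mQ q) + sOf q + 1 ≤ nOf q * P.Sm (mQ q) + P.Sm (mQ q) := by omega
      _ = (nOf q + 1) * P.Sm (mQ q) := by ring
      _ ≤ P.Gm (mQ q) * P.Sm (mQ q) := Nat.mul_le_mul_right _ hn
  calc (nOf q * P.Sm (mQ q) + sOf q + 1) * P.Wd (mQ q) ≤ (P.Gm (mQ q) * P.Sm (mQ q)) * P.Wd (mQ q) :=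
        Nat.mul_le_mul_right _ h1
    _ = P.Gm (mQ q) * (P.Sm (mQ q) * P.Wd (mQ q)) := by ring

/-- `E₀ ≤ E₁`. [folklore] -/
theorem E0_le_E1 : P.E0 q ≤ P.E1 q := by
  unfold E0 E1; exact Nat.mul_le_mul_right _ (Nat.le_succ _)

/-- Value of `U0`. [folklore] -/
theorem U0_apply (hn : nOf q < P.Gm (mQ q)) (hs : sOf q < P.Sm (mQ q)) : P.U0 q = ones (P.E0 q) := by
  simp only [U0, Function.comp_apply, pairFn_apply, rulerQ_apply, binE0_apply, binToUnaryFn_boolPair, bitsToNat_encodeNat,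
    length_ones_eq]
  rw [min_eq_left ((P.E0_le_E1 q).trans (P.E1_le_learnLen q hn hs))]

/-- Value of `U1`. [folklore] -/
theorem U1_apply (hn : nOf q < P.Gm (mQ q)) (hs : sOf q < P.Sm (mQ q)) : P.U1 q = ones (P.E1 q) := by
  simp only [U1, Function.comp_apply, pairFn_apply, rulerQ_apply, binE1_apply, binToUnaryFn_boolPair, bitsToNat_encodeNat,
    length_ones_eq]
  rw [min_eq_left (P.E1_le_learnLen q hn hs)]

/-- **The block brick computes `blockOf`** (for `n < Gm`, `s < Sm`). [cite: AaronsonChen2017, §5.3 (p. 22)] -/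
theorem blockF_apply (hn : nOf q < P.Gm (mQ q)) (hs : sOf q < P.Sm (mQ q)) :
    P.blockF q = P.blockOf (fstP (wQ q)) (sndP (wQ q)) (hQ q) (nOf q) (sOf q) := by
  simp only [blockF, Function.comp_apply, pairFn_apply, takeFn_boolPair, dropFn_boolPair, P.U0_apply q hn hs, length_ones_eq,
    polyFn_apply, eval_WdP, evensT_eval, length_wQ]
  unfold blockOf E0 mQ mmOf
  rw [show wl (fstP (wQ q)) (sndP (wQ q)) = wl (fstP (fstP (zQ q))) (sndP (fstP (zQ q))) by
    simp [wQ, repZ_apply]]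

/-- Value of `halfH`. [folklore] -/
theorem halfH_apply : halfH q = ones ((hQ q).length / 2) := by
  simp [halfH, onesFn_apply]

/-- Value of `posF`. [folklore] -/
theorem posF_apply (hn : nOf q < P.Gm (mQ q)) (hs : sOf q < P.Sm (mQ q)) : P.posF q = ones (2 * P.E1 q - 1) := by
  simp only [posF, Function.comp_apply, pairFn_apply, concatFn_boolPair, P.U1_apply q hn hs, ones, ← List.replicate_add,
    List.tail_replicate]
  congr 1
  omega

end Values

/-! ### The seven conditions as `P` languages -/

/-- `C1`: `n ≤ |τ|`. [folklore] -/
def C1 : Language Bool := pairFn tauQ nQ ⁻¹' LenLe X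
/-- `C2`: `n < Gm(wl)`. [folklore] -/
def C2 : Language Bool := pairFn wQ nQ ⁻¹' LenLt P.pF
/-- `C3`: `s < Sm(wl)`. [folklore] -/
def C3 : Language Bool := pairFn wQ sQ ⁻¹' LenLt P.SmP
/-- `C4`: `E₁ ≤ ⌊|h|/2⌋`, as `⟦binE1⟧ < |1^{⌊|h|/2⌋} 1|`. [folklore] -/
def C4 : Language Bool := pairFn (concatFn ∘ pairFn halfH (fun _ => [true])) P.binE1 ⁻¹' {u | bitsToNat (sndP u) < (fstP u).length}
/-- `C5`: the block is real (`1 ∈ block`). [folklore] -/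
def C5 : Language Bool := P.blockF ⁻¹' HasBit true
/-- `C6`: the `O`-answer closing the slot is `1` (`h_{2E₁−1} = 1`). [folklore] -/
def C6 : Language Bool := {q | (hQ q).getD (P.posF q).length false = true}
/-- `C7`: `v` is the decoded payload of the block. [folklore] -/
def C7 : Language Bool := {q | vQ q = (decodePadT.eval ∘ P.blockF) q}

/-- **The witnessed table relation**: all seven conditions. [cite: AaronsonChen2017, §5.3 (p. 22, "f_known")] -/
def TabRel : Language Bool := C1 ⊓ (P.C2 ⊓ (P.C3 ⊓ (P.C4 ⊓ (P.C5 ⊓ (P.C6 ⊓ P.C7)))))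

/-- `C1 ∈ P`. [folklore] -/
theorem C1_mem_P : C1 ∈ Classes.P :=
  preimage_mem_P (LenLe_mem_P _) (pairFn_mem_FP (comp_mem_FP fstP_mem_FP (comp_mem_FP sndP_mem_FP fstP_mem_FP))
    (comp_mem_FP fstP_mem_FP sndP_mem_FP))
/-- `C2 ∈ P`. [folklore] -/
theorem C2_mem_P : P.C2 ∈ Classes.P :=
  preimage_mem_P (LenLt_mem_P _) (pairFn_mem_FP wQ_mem_FP (comp_mem_FP fstP_mem_FP sndP_mem_FP))
/-- `C3 ∈ P`. [folklore] -/
theorem C3_mem_P : P.C3 ∈ Classes.P :=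
  preimage_mem_P (LenLt_mem_P _) (pairFn_mem_FP wQ_mem_FP (comp_mem_FP sndP_mem_FP sndP_mem_FP))
/-- `C4 ∈ P`. [folklore] -/
theorem C4_mem_P : P.C4 ∈ Classes.P :=
  preimage_mem_P valLtLen_mem_P (pairFn_mem_FP (comp_mem_FP concatFn_mem_FP (pairFn_mem_FP halfH_mem_FP (const_mem_FP _)))
    P.binE1_mem_FP)
/-- `C5 ∈ P`. [folklore] -/
theorem C5_mem_P : P.C5 ∈ Classes.P := preimage_mem_P (HasBit_mem_P true) P.blockF_mem_FP
/-- `C6 ∈ P`. [folklore] -/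
theorem C6_mem_P : P.C6 ∈ Classes.P := setOf_getD_mem_P P.posF_mem_FP hQ_mem_FP
/-- `C7 ∈ P`. [folklore] -/
theorem C7_mem_P : P.C7 ∈ Classes.P :=
  setOf_apply_eq_apply_mem_P (comp_mem_FP sndP_mem_FP (comp_mem_FP sndP_mem_FP fstP_mem_FP))
    (comp_mem_FP decodePadT.polyTimeComputable_eval P.blockF_mem_FP)

/-- `TabRel ∈ P`. [cite: AroraBarakCC2009, §1.3] -/
theorem TabRel_mem_P : P.TabRel ∈ Classes.P :=
  inter_mem_P C1_mem_P (inter_mem_P P.C2_mem_P (inter_mem_P P.C3_mem_P (inter_mem_P P.C4_mem_P (inter_mem_P P.C5_mem_P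
    (inter_mem_P P.C6_mem_P P.C7_mem_P)))))

/-- **Membership in `TabRel`**, read as the conditions of `tabsOf` on `(n, s) = (|1ⁿ|, |1ˢ|)`. [folklore] -/
theorem mem_TabRel_iff (q : List Bool) :
    q ∈ P.TabRel ↔ nOf q ≤ (tauQ q).length ∧ nOf q < P.Gm (mQ q) ∧ sOf q < P.Sm (mQ q) ∧
      P.E1 q ≤ (hQ q).length / 2 ∧ true ∈ P.blockOf (fstP (wQ q)) (sndP (wQ q)) (hQ q) (nOf q) (sOf q) ∧
      (hQ q).getD (2 * P.E1 q - 1) false = true ∧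
      vQ q = decodePad (P.blockOf (fstP (wQ q)) (sndP (wQ q)) (hQ q) (nOf q) (sOf q)) := by
  have e1 : q ∈ C1 ↔ nOf q ≤ (tauQ q).length := by
    unfold C1; rw [memL_preimage, pairFn_apply, boolPair_mem_LenLe, eval_X]
  have e2 : q ∈ P.C2 ↔ nOf q < P.Gm (mQ q) := by
    unfold C2; rw [memL_preimage, pairFn_apply, boolPair_mem_LenLt, length_wQ]; rfl
  have e3 : q ∈ P.C3 ↔ sOf q < P.Sm (mQ q) := by
    unfold C3; rw [memL_preimage, pairFn_apply, boolPair_mem_LenLt, length_wQ, eval_SmP]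
  have e4 : q ∈ P.C4 ↔ P.E1 q ≤ (hQ q).length / 2 := by
    unfold C4
    rw [memL_preimage, pairFn_apply]
    change bitsToNat (sndP (boolPair _ _)) < (fstP (boolPair _ _)).length ↔ _
    rw [sndP_boolPair, fstP_boolPair, binE1_apply, bitsToNat_encodeNat, Function.comp_apply, pairFn_apply, concatFn_boolPair,
      halfH_apply, List.length_append, length_ones_eq, List.length_singleton]
    omega
  change q ∈ C1 ⊓ (P.C2 ⊓ (P.C3 ⊓ (P.C4 ⊓ (P.C5 ⊓ (P.C6 ⊓ P.C7))))) ↔ _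
  simp only [Language.mem_inf, e1, e2, e3, e4]
  constructor
  · rintro ⟨h1, h2, h3, h4, h5, h6, h7⟩
    refine ⟨h1, h2, h3, h4, ?_, ?_, ?_⟩
    · have h5' : true ∈ P.blockF q := h5
      rwa [P.blockF_apply q h2 h3] at h5'
    · have h6' : (hQ q).getD (P.posF q).length false = true := h6
      rwa [P.posF_apply q h2 h3, length_ones_eq] at h6'
    · have h7' : vQ q = decodePadT.eval (P.blockF q) := h7
      rwa [decodePadT_eval, P.blockF_apply q h2 h3] at h7'
  · rintro ⟨h1, h2, h3, h4, h5, h6, h7⟩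
    refine ⟨h1, h2, h3, h4, ?_, ?_, ?_⟩
    · show true ∈ P.blockF q
      rwa [P.blockF_apply q h2 h3]
    · show (hQ q).getD (P.posF q).length false = true
      rwa [P.posF_apply q h2 h3, length_ones_eq]
    · show vQ q = decodePadT.eval (P.blockF q)
      rwa [decodePadT_eval, P.blockF_apply q h2 h3]

/-! ### The table language -/

/-- The witness bound `2·Gm(m) + Sm(m) + 2` of the pair `⟨1ⁿ, 1ˢ⟩`. [folklore] -/
def tabWitP : Polynomial ℕ := 2 * P.pF + P.SmP + 2

/-- **The table language**: `⟨⟨w, h⟩, ⟨τ, v⟩⟩` such that some `⟨1ⁿ, 1ˢ⟩` of polynomial length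
witnesses the seven conditions — by `mem_TabLang_iff`, exactly `v ∈ tabsOf x₀ r h |τ|`.
[cite: AaronsonChen2017, §5.3 (p. 22, "g(x) = f_known(x)")] -/
def TabLang : Language Bool := {x | ∃ y : List Bool, y.length ≤ P.tabWitP.eval x.length ∧ boolPair x y ∈ P.TabRel}

/-- **`TabLang ∈ PSPACE`** (a polynomially bounded `∃` over a `P` relation). [cite: AroraBarakCC2009, Thm. 4.2 and §4.1] -/
theorem TabLang_mem_PSPACE : P.TabLang ∈ PSPACE :=
  polyExists_mem_PSPACE (P_subset_PSPACE_holds P.TabRel_mem_P) P.tabWitP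

/-- Accessor values on a witnessed instance. [folklore] -/
theorem accessors_boolPair (w h τ v y : List Bool) :
    zQ (boolPair (boolPair (boolPair w h) (boolPair τ v)) y) = boolPair w h ∧
    hQ (boolPair (boolPair (boolPair w h) (boolPair τ v)) y) = h ∧
    tauQ (boolPair (boolPair (boolPair w h) (boolPair τ v)) y) = τ ∧
    vQ (boolPair (boolPair (boolPair w h) (boolPair τ v)) y) = v ∧
    nQ (boolPair (boolPair (boolPair w h) (boolPair τ v)) y) = fstP y ∧
    sQ (boolPair (boolPair (boolPair w h) (boolPair τ v)) y) = sndP y ∧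
    wQ (boolPair (boolPair (boolPair w h) (boolPair τ v)) y) = boolPair (fstP w) (sndP w) ∧
    mQ (boolPair (boolPair (boolPair w h) (boolPair τ v)) y) = wl (fstP w) (sndP w) := by
  refine ⟨by simp, by simp, by simp, by simp, by simp, by simp, by simp [wQ, repZ_apply], ?_⟩
  simp [mQ, mmOf]

/-- **`TabLang` decides the learned tables**: `⟨⟨w, h⟩, ⟨τ, v⟩⟩ ∈ TabLang ↔ v ∈ tabsOf x₀ r h |τ|`,
`⟨x₀, r⟩ = boolUnpair w`. [cite: AaronsonChen2017, §5.3 (p. 22, "f_known")] -/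
theorem mem_TabLang_iff (w h τ v : List Bool) :
    boolPair (boolPair w h) (boolPair τ v) ∈ P.TabLang ↔ v ∈ P.tabsOf (fstP w) (sndP w) h τ.length := by
  have key : ∀ y : List Bool, boolPair (boolPair (boolPair w h) (boolPair τ v)) y ∈ P.TabRel ↔
      (fstP y).length ≤ τ.length ∧ (fstP y).length < P.Gm (wl (fstP w) (sndP w)) ∧ (sndP y).length < P.Sm (wl (fstP w) (sndP w)) ∧
      ((fstP y).length * P.Sm (wl (fstP w) (sndP w)) + (sndP y).length + 1) * P.Wd (wl (fstP w) (sndP w)) ≤ h.length / 2 ∧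
      true ∈ P.blockOf (fstP w) (sndP w) h (fstP y).length (sndP y).length ∧
      h.getD (2 * (((fstP y).length * P.Sm (wl (fstP w) (sndP w)) + (sndP y).length + 1) * P.Wd (wl (fstP w) (sndP w))) - 1) false = true ∧
      v = decodePad (P.blockOf (fstP w) (sndP w) h (fstP y).length (sndP y).length) := by
    intro y
    obtain ⟨hz, hh, ht, hv, hn, hs, hw, hm⟩ := accessors_boolPair w h τ v y
    rw [mem_TabRel_iff]
    unfold E1 nOf sOf
    rw [hh, ht, hv, hn, hs, hw, hm, fstP_boolPair, sndP_boolPair]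
  constructor
  · rintro ⟨y, -, hy⟩
    obtain ⟨h1, h2, h3, h4, h5, h6, h7⟩ := (key y).1 hy
    exact ⟨(fstP y).length, (sndP y).length, h1, h2, h3, h4, h5, h6, h7⟩
  · rintro ⟨n, s, h1, h2, h3, h4, h5, h6, h7⟩
    refine ⟨boolPair (ones n) (ones s), ?_, (key _).2 ?_⟩
    · -- the witness bound
      have hwl : wl (fstP w) (sndP w) ≤ (boolPair (boolPair w h) (boolPair τ v)).length := by
        unfold wl
        have h1 := length_boolUnpair_parts_le w
        change (boolPair (boolUnpair w).1 (boolUnpair w).2).length ≤ _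
        simp only [length_boolPair] at h1 ⊢
        omega
      have hG : P.Gm (wl (fstP w) (sndP w)) ≤ P.pF.eval (boolPair (boolPair w h) (boolPair τ v)).length := TM2Iter.eval_mono _ hwl
      have hS : P.Sm (wl (fstP w) (sndP w)) ≤ P.SmP.eval (boolPair (boolPair w h) (boolPair τ v)).length := by
        rw [← eval_SmP]; exact TM2Iter.eval_mono _ hwl
      have hy : (boolPair (ones n) (ones s)).length = 2 * n + 2 + s := by
        rw [length_boolPair, length_ones_eq, length_ones_eq]
      rw [hy]
      simp only [tabWitP, eval_add, eval_mul, eval_ofNat]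
      omega
    · simp only [fstP_boolPair, sndP_boolPair, length_ones_eq]
      exact ⟨h1, h2, h3, h4, h5, h6, h7⟩

end AcProto

end Literature.Barriers.QuantumAdvantage

end

/-! ## Part 2 (`AaronsonChenWalkAtoms`): Aaronson–Chen 2017, Lemma 5.3: the guessed walk of the replaced circuit, its atoms, and the consistency of the guesses as a `PSPACE` predicate

Machine-level file for the `PSPACE` membership of the physical predicates `HeavyLang`/`CdfLang` of
the simulator's advice language ("all the computations can be done in `PSPACE`",
[AaronsonChen2017, §5.3 p. 23]). By `AaronsonChenAdviceWeights.lean` both are integer tests on the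
path-pair counts `annSetA`/`annSetB` of the ANNOTATED replaced circuit `annTab (tabsOf x₀ r h) (gates ↾ n)`
from the basis label `w0 x₀`, and by `GuessedAnnRuns.lean` (`annSetA_eq_sum_consG`) these counts are
sums, over pairs of coin strings CONSISTENT with the gates' own languages `TQBF ⊕ tabsOf x₀ r h t`,
of pair terms read off the guessed total walk `ADH.tRunO` of the plain gate list — the walk that the
Aaronson–Ambainis machine files already compute in polynomial time for a uniform family
(`ADHOracleWalk.lean`: `walkO`; `AaronsonAmbainisThm23Atoms.lean`: the atoms `orcT`, `coinT`, `qryF`,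
`liveT`, `hadT`, `vldT`, `labF`, `phkF`). This file supplies:

* the PREFIX atoms `AcWalk.pvldT/plabF/pphkF` (validity, label, phase `+k mod 8` of the walk of the
  first `t` gates, read off `walkO`), in `FP` for a uniform family, with their values;
* on the words `y = ⟨⟨z, c⟩, τ⟩` (`z = ⟨⟨x₀, r⟩, ⟨h, …⟩⟩` an advice-type instance, `c` the coins, `|τ|`
  the round): the argument maps, the query `qY`, and **`JLang`** — "the query of round `|τ|` is in
  `TQBF ⊕ tabsOf x₀ r h |τ|`" — in `PSPACE` (`TQBF_mem_PSPACE`, `TabLang_mem_PSPACE`), `mem_JLang_iff`;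
* **`ConsLang tN`** — "for every round `t < |tN z|`: if gate `t` is a live query gate its coin is the
  answer of its own language to its query, and coins beyond the circuit are `0`" — in `PSPACE`
  (bounded `∀` over a Boolean combination), and **`mem_ConsLang_iff`**: membership of `⟨z, c⟩` is
  `ADH.ConsG (annTab (tabsOf x₀ r h) (gates ↾ n)) c (w0 x₀)` together with the vanishing of the coins
  past the circuit.

No named facts.

## References

* [AaronsonChen2017] arXiv:1612.05903, §5.3 (pp. 22–23), read via `lit read arxiv:1612.05903 --pages 19-25`.
* [AaronsonAmbainis2014] proof of Thm. 23 (p. 14: walking guessed paths in polynomial time), as the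
  tree's `ADHOracleWalk.lean` / `AaronsonAmbainisThm23Atoms.lean`.
* [AroraBarakCC2009] Thm. 4.2/§4.1 (closure of `PSPACE` under bounded quantifiers), §4.2.
-/

noncomputable section

namespace Literature.Barriers.QuantumAdvantage

open MeasureTheory _root_.Computability Polynomial Literature.Computability.Complexity
  Literature.Computability.Complexity.Brick Literature.Computability.Complexity.Plumb
  Literature.Computability.Complexity.OracleCompose Literature.Computability.Complexity.PRelSigma
  Literature.Computability.Complexity.TTClosure Literature.Computability.Complexity.StrEq
  Literature.Computability.Cryptography Literature.Computability.QuantumComplexity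
  Literature.Computability.QuantumComplexity.ADH

attribute [-simp] Brick.nthF_zero Brick.sndPow_zero

/-! ### Prefix atoms of the guessed walk -/

namespace AcWalk

variable (F : QCircuitFamily cliffordT)

/-- Validity of the walk of the first `t` gates, one bit. [folklore] -/
def pvldT : List Bool → List Bool := vT ∘ walkO F
/-- The label after the first `t` gates. [folklore] -/
def plabF : List Bool → List Bool := wF ∘ walkO F
/-- The phase after the first `t` gates plus `k`, modulo `8`, in unary. [folklore] -/
def pphkF (k : ℕ) : List Bool → List Bool := addPh k ∘ walkO F

variable {F} in
/-- The prefix atoms are in `FP` for a uniform family. [cite: AroraBarak2009, §1.3, §6.2] -/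
theorem patoms_mem_FP (hU : F.IsUniform) : pvldT F ∈ FP ∧ plabF F ∈ FP ∧ ∀ k, pphkF F k ∈ FP :=
  ⟨comp_mem_FP vT_mem_FP (walkO_mem_FP F hU), comp_mem_FP (nthF_mem_FP 3) (walkO_mem_FP F hU),
    fun k => comp_mem_FP (addPh_mem_FP k) (walkO_mem_FP F hU)⟩

variable (x c : List Bool)

/-- The guessed state after the first `t` gates (all of them for `t ≥ μ`). [folklore] -/
abbrev pst (t : ℕ) : TState (x.length + F.ancillas x.length) :=
  tRunO ((F.circ x.length).gates.take t) c (w₀ F x, 0, true)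

/-- The record of the counted walk at ANY round count `t`: codes ahead, unread coins, and the state
`pst t` (for `t ≥ μ` the walk is complete: `walkO_apply_of_le`, `gates.take t = gates`). [folklore] -/
theorem walkO_apply_all (t : ℕ) :
    ∃ E co : List Bool, walkO F (boolPair x (boolPair c (encodeNat t))) =
      rec6 (F.descFn x) E co (List.ofFn (pst F x c t).1) (ones (pst F x c t).2.1) [(pst F x c t).2.2] := by
  by_cases ht : t ≤ (F.circ x.length).gates.length
  · exact ⟨_, _, walkO_apply F x c ht⟩
  · refine ⟨[], c.drop (F.circ x.length).gates.length, ?_⟩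
    rw [walkO_apply_of_le F x c (not_le.1 ht).le]
    simp only [pst, List.take_of_length_le (not_le.1 ht).le]

/-- **Value of `pvldT`**: the validity flag of `pst t`. [folklore] -/
theorem pvldT_apply (t : ℕ) : pvldT F (boolPair x (boolPair c (encodeNat t))) = [(pst F x c t).2.2] := by
  obtain ⟨E, co, h⟩ := walkO_apply_all F x c t
  simp only [pvldT, Function.comp_apply, h, vT_apply]
  simp [rec6, sndPow]

/-- **Value of `plabF`**: the label of `pst t`. [folklore] -/
theorem plabF_apply (t : ℕ) : plabF F (boolPair x (boolPair c (encodeNat t))) = List.ofFn (pst F x c t).1 := by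
  obtain ⟨E, co, h⟩ := walkO_apply_all F x c t
  simp only [plabF, Function.comp_apply, h]
  simp [rec6, nthF]

/-- **Value of `pphkF k`**: `1^{(φ + k) mod 8}`, `φ` the phase of `pst t`. [folklore] -/
theorem pphkF_apply (k t : ℕ) : pphkF F k (boolPair x (boolPair c (encodeNat t))) = ones (((pst F x c t).2.1 + k) % 8) := by
  obtain ⟨E, co, h⟩ := walkO_apply_all F x c t
  simp only [pphkF, Function.comp_apply, addPh_apply, h]
  simp [rec6, nthF]

end AcWalk

/-! ### Accessors on `y = ⟨⟨z, c⟩, τ⟩`, `z = ⟨⟨x₀, r⟩, ⟨h, …⟩⟩` -/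

namespace AcProto

variable (P : AcProto)

section Accessors

/-- The instance `z`. [folklore] -/
abbrev zY : List Bool → List Bool := fstP ∘ fstP
/-- The coins `c`. [folklore] -/
abbrev cY : List Bool → List Bool := sndP ∘ fstP
/-- The round numeral `τ`. [folklore] -/
abbrev tauY : List Bool → List Bool := sndP
/-- The game input `x₀`. [folklore] -/
abbrev x0Y : List Bool → List Bool := fstP ∘ fstP ∘ fstP ∘ fstP
/-- The re-pairable part `w = ⟨x₀, r⟩`. [folklore] -/
abbrev wwY : List Bool → List Bool := fstP ∘ fstP ∘ fstP
/-- The history `h`. [folklore] -/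
abbrev hY' : List Bool → List Bool := fstP ∘ sndP ∘ fstP ∘ fstP

/-- The argument `⟨x₀, ⟨c, bin |τ|⟩⟩` of the walk atoms. [folklore] -/
def atomArg : List Bool → List Bool := pairFn x0Y (pairFn cY (lenBinF ∘ tauY))

/-- `atomArg ∈ FP`. [folklore] -/
theorem atomArg_mem_FP : atomArg ∈ FP :=
  pairFn_mem_FP (comp_mem_FP fstP_mem_FP (comp_mem_FP fstP_mem_FP (comp_mem_FP fstP_mem_FP fstP_mem_FP)))
    (pairFn_mem_FP (comp_mem_FP sndP_mem_FP fstP_mem_FP) (comp_mem_FP lenBinF_mem_FP sndP_mem_FP))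

/-- Value of `atomArg`. [folklore] -/
theorem atomArg_boolPair (z c τ : List Bool) :
    atomArg (boolPair (boolPair z c) τ) = boolPair (fstP (fstP z)) (boolPair c (encodeNat τ.length)) := by
  simp [atomArg]

end Accessors

/-- The query of round `|τ|` of the walk with coins `c` on the circuit of `x₀`. [cite: AaronsonChen2017, §5.3 (p. 23)] -/
def qY : List Bool → List Bool := qryF P.F ∘ atomArg
/-- "Gate `|τ|` is a query gate", one bit. [folklore] -/
def orcY : List Bool → List Bool := orcT P.F ∘ atomArg
/-- The coin of round `|τ|`, one bit. [folklore] -/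
def coinY : List Bool → List Bool := coinT P.F ∘ atomArg
/-- "Round `|τ|` is live", one bit. [folklore] -/
def liveY : List Bool → List Bool := liveT P.F ∘ atomArg

/-- The argument `⟨⟨w, h⟩, ⟨τ, tail q⟩⟩` of the table language for the `1`-side payload of the query. [folklore] -/
def tabArgY : List Bool → List Bool := pairFn (pairFn wwY hY') (pairFn tauY (List.tail ∘ P.qY))

variable {P} in
/-- The atoms on `y` are in `FP` for a uniform family. [folklore] -/
theorem yatoms_mem_FP (hU : P.F.IsUniform) : P.qY ∈ FP ∧ P.orcY ∈ FP ∧ P.coinY ∈ FP ∧ P.liveY ∈ FP ∧ P.tabArgY ∈ FP := by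
  obtain ⟨-, -, -, -, hlive, horc, -, hcoin, hq, -⟩ := atoms_mem_FP hU
  have hqY : P.qY ∈ FP := comp_mem_FP hq atomArg_mem_FP
  exact ⟨hqY, comp_mem_FP horc atomArg_mem_FP, comp_mem_FP hcoin atomArg_mem_FP, comp_mem_FP hlive atomArg_mem_FP,
    pairFn_mem_FP (pairFn_mem_FP (comp_mem_FP fstP_mem_FP (comp_mem_FP fstP_mem_FP fstP_mem_FP))
      (comp_mem_FP fstP_mem_FP (comp_mem_FP sndP_mem_FP (comp_mem_FP fstP_mem_FP fstP_mem_FP))))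
      (pairFn_mem_FP sndP_mem_FP (comp_mem_FP tail_mem_FP hqY))⟩

/-! ### The answer language of round `|τ|`: `q ∈ TQBF ⊕ tabsOf x₀ r h |τ|` -/

/-- **The answer language**: the query of round `|τ|` is a `0`-side query `0p` with `p ∈ TQBF`, or a
`1`-side query `1p` with `p` in the learned table of stage `|τ|` (`TabLang`).
[cite: AaronsonChen2017, §5.3 (p. 22, "g(x) = f_known(x)"; §5 p. 20, the oracle TQBF ⊕ O)] -/
def JLang : Language Bool :=
  (({y | (take1Fn ∘ P.qY) y = (fun _ => [false]) y} : Language Bool) ⊓ ((List.tail ∘ P.qY) ⁻¹' TQBF : Language Bool)) ⊔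
    (({y | (take1Fn ∘ P.qY) y = (fun _ => [true]) y} : Language Bool) ⊓ (P.tabArgY ⁻¹' P.TabLang : Language Bool))

variable {P} in
/-- **`JLang ∈ PSPACE`** (`TQBF ∈ PSPACE`, `TabLang ∈ PSPACE`, a union through a complete set).
[cite: AroraBarakCC2009, Thm. 4.13 (first half) and §4.2] -/
theorem JLang_mem_PSPACE (hU : P.F.IsUniform) : P.JLang ∈ PSPACE := by
  obtain ⟨B, hB⟩ := exists_isComplete_PSPACE_holds
  obtain ⟨hq, -, -, -, htab⟩ := yatoms_mem_FP hU
  have h1 : ∀ b : Bool, ({y | (take1Fn ∘ P.qY) y = (fun _ => [b]) y} : Language Bool) ∈ Classes.P := fun b =>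
    setOf_apply_eq_apply_mem_P (comp_mem_FP take1Fn_mem_FP hq) (const_mem_FP _)
  exact union_mem_PSPACE_of_complete hB
    (inter_P_mem_PSPACE (h1 false) (preimage_mem_PSPACE TQBF_mem_PSPACE (comp_mem_FP tail_mem_FP hq)))
    (inter_P_mem_PSPACE (h1 true) (preimage_mem_PSPACE P.TabLang_mem_PSPACE htab))

/-- Membership in an `oracleJoin` by the first symbol. [folklore] -/
theorem mem_oracleJoin_iff_take (A B : Language Bool) (q : List Bool) :
    q ∈ oracleJoin A B ↔ (q.take 1 = [false] ∧ q.tail ∈ A) ∨ (q.take 1 = [true] ∧ q.tail ∈ B) := by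
  rcases q with _ | ⟨b, p⟩
  · simp
  · cases b <;> simp

/-- **Membership in `JLang`**: the query of round `|τ|` is answered `1` by `TQBF ⊕ tabsOf x₀ r h |τ|`.
[cite: AaronsonChen2017, §5.3 (p. 22)] -/
theorem mem_JLang_iff (z c τ : List Bool) :
    boolPair (boolPair z c) τ ∈ P.JLang ↔
      P.qY (boolPair (boolPair z c) τ) ∈
        oracleJoin TQBF (P.tabsOf (fstP (fstP z)) (sndP (fstP z)) (fstP (sndP z)) τ.length) := by
  rw [mem_oracleJoin_iff_take]
  have htab : P.tabArgY (boolPair (boolPair z c) τ) =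
      boolPair (boolPair (fstP z) (fstP (sndP z))) (boolPair τ (P.qY (boolPair (boolPair z c) τ)).tail) := by
    simp [tabArgY]
  unfold JLang
  rw [StockMachine.memL_sup, StockMachine.memL_inf, StockMachine.memL_inf, memL_preimage, memL_preimage,
    StockMachine.memL_setOf, StockMachine.memL_setOf, htab, mem_TabLang_iff]
  simp only [Function.comp_apply, take1Fn]
  exact Iff.rfl

/-- A Boolean indicator is the `decide` of membership. [folklore] -/
theorem boolIndicator_eq_decide' {α : Type*} (s : Set α) (a : α) [Decidable (a ∈ s)] :
    s.boolIndicator a = decide (a ∈ s) := by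
  by_cases h : a ∈ s
  · rw [(s.mem_iff_boolIndicator a).1 h, decide_eq_true h]
  · rw [(s.notMem_iff_boolIndicator a).1 h, decide_eq_false h]

/-! ### The consistency language -/

section Cons

variable (tN : List Bool → List Bool)

/-- **The per-round consistency condition** on `y = ⟨⟨z, c⟩, τ⟩`, `t = |τ|`: if `t < |tN z|` then
(i) when round `t` is live and gate `t` is a query gate, its coin is `1` iff its query is in its own
language, and (ii) when round `t` is past the circuit, coin `t` is `0`.
[cite: AaronsonChen2017, §5.3 (p. 23, "Analysis of the final circuit")] -/
def ConsBody : Language Bool :=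
  {y | (tauY y).length < (tN (zY y)).length →
    (P.liveY y = [true] → P.orcY y = [true] → (P.coinY y = [true] ↔ y ∈ P.JLang)) ∧
    (¬ P.liveY y = [true] → ¬ (cY y).getD (tauY y).length false = true)}

/-- **The consistency language** on `v = ⟨z, c⟩`: every round `τ` of polynomially bounded length
satisfies `ConsBody`. [cite: AaronsonChen2017, §5.3 (p. 23)] -/
def ConsLang : Language Bool :=
  {v | ∀ τ : List Bool, τ.length ≤ (X + P.pF).eval v.length → boolPair v τ ∈ P.ConsBody tN}

variable {P tN} in
/-- **`ConsLang ∈ PSPACE`** for a uniform family and `tN ∈ FP`. [cite: AroraBarakCC2009, Thm. 4.2 and §4.2] -/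
theorem ConsLang_mem_PSPACE (hU : P.F.IsUniform) (htN : tN ∈ FP) : P.ConsLang tN ∈ PSPACE := by
  obtain ⟨B, hB⟩ := exists_isComplete_PSPACE_holds
  obtain ⟨-, horc, hcoin, hlive, -⟩ := yatoms_mem_FP hU
  have hPS : ∀ {L : Language Bool}, L ∈ Classes.P → L ∈ PSPACE := fun h => P_subset_PSPACE_holds h
  have hG : ({y | (tauY y).length < (tN (zY y)).length} : Language Bool) ∈ Classes.P :=
    mem_P_of_iff (preimage_mem_P (LenLt_mem_P X) (pairFn_mem_FP (comp_mem_FP htN (comp_mem_FP fstP_mem_FP fstP_mem_FP)) sndP_mem_FP))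
      _ fun y => by rw [memL_preimage, pairFn_apply, boolPair_mem_LenLt, eval_X]; rfl
  have hbit : ∀ {f : List Bool → List Bool}, f ∈ FP → ({y | f y = [true]} : Language Bool) ∈ Classes.P := fun hf =>
    setOf_apply_eq_apply_mem_P hf (const_mem_FP _)
  have hZ : ({y | (cY y).getD (tauY y).length false = true} : Language Bool) ∈ Classes.P :=
    setOf_getD_mem_P sndP_mem_FP (comp_mem_FP sndP_mem_FP fstP_mem_FP)
  have hJ := JLang_mem_PSPACE hU
  have hbody :=
    setOf_imp_mem_PSPACE_of_complete hB (hPS hG)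
      (setOf_and_mem_PSPACE_of_complete hB
        (setOf_imp_mem_PSPACE_of_complete hB (hPS (hbit hlive))
          (setOf_imp_mem_PSPACE_of_complete hB (hPS (hbit horc))
            (setOf_and_mem_PSPACE_of_complete hB
              (setOf_imp_mem_PSPACE_of_complete hB (hPS (hbit hcoin)) hJ)
              (setOf_imp_mem_PSPACE_of_complete hB hJ (hPS (hbit hcoin))))))
        (setOf_imp_mem_PSPACE_of_complete hB (compl_mem_PSPACE (hPS (hbit hlive))) (compl_mem_PSPACE (hPS hZ))))
  have hbody' : P.ConsBody tN ∈ PSPACE := by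
    refine mem_PSPACE_of_iff' hbody _ fun y => ?_
    change ((tauY y).length < (tN (zY y)).length →
      (P.liveY y = [true] → P.orcY y = [true] → (P.coinY y = [true] ↔ y ∈ P.JLang)) ∧
      (¬ P.liveY y = [true] → ¬ (cY y).getD (tauY y).length false = true)) ↔
      ((tauY y).length < (tN (zY y)).length →
      (P.liveY y = [true] → P.orcY y = [true] → (P.coinY y = [true] → y ∈ P.JLang) ∧ (y ∈ P.JLang → P.coinY y = [true])) ∧
      (¬ P.liveY y = [true] → ¬ (cY y).getD (tauY y).length false = true))
    simp only [iff_def]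
  exact polyForall_mem_PSPACE hbody' (X + P.pF)

/-- The relevant rounds are within the quantifier bound: `|tN z| ≤ |⟨z, c⟩| + pF(|⟨z, c⟩|)`. [folklore] -/
def RoundsBounded (z c : List Bool) : Prop :=
  (tN z).length ≤ (boolPair z c).length + P.pF.eval (boolPair z c).length

variable {P tN}

/-- One instance of `ConsBody` on the intended arguments. [folklore] -/
theorem boolPair_mem_ConsBody_iff (z c τ : List Bool) :
    boolPair (boolPair z c) τ ∈ P.ConsBody tN ↔
      (τ.length < (tN z).length →
        (liveT P.F (boolPair (fstP (fstP z)) (boolPair c (encodeNat τ.length))) = [true] →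
          orcT P.F (boolPair (fstP (fstP z)) (boolPair c (encodeNat τ.length))) = [true] →
            (coinT P.F (boolPair (fstP (fstP z)) (boolPair c (encodeNat τ.length))) = [true] ↔
              qryF P.F (boolPair (fstP (fstP z)) (boolPair c (encodeNat τ.length))) ∈
                oracleJoin TQBF (P.tabsOf (fstP (fstP z)) (sndP (fstP z)) (fstP (sndP z)) τ.length))) ∧
        (¬ liveT P.F (boolPair (fstP (fstP z)) (boolPair c (encodeNat τ.length))) = [true] → ¬ c.getD τ.length false = true)) := by
  have hJ := P.mem_JLang_iff z c τ
  unfold ConsBody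
  rw [StockMachine.memL_setOf, hJ]
  simp only [liveY, orcY, coinY, qY, Function.comp_apply, atomArg_boolPair]
  simp

/-- **Membership in `ConsLang`**: for `v = ⟨z, c⟩` with `z = ⟨⟨x₀, r⟩, ⟨h, …⟩⟩` and `n = |tN z|` within the
quantifier bound, the coins `c` are consistent with the annotated replaced prefix
`annTab (tabsOf x₀ r h) (gates ↾ n)` from `w0 x₀` (in the sense of `ADH.ConsG`), and vanish at the
rounds `μ ≤ t < n` past the circuit. [cite: AaronsonChen2017, §5.3 (p. 23, "all the computations can be done in PSPACE")] -/
theorem mem_ConsLang_iff (z c : List Bool) (hb : P.RoundsBounded tN z c) :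
    boolPair z c ∈ P.ConsLang tN ↔
      ConsG (AcSim.annTab (P.tabsOf (fstP (fstP z)) (sndP (fstP z)) (fstP (sndP z))) ((P.gates (fstP (fstP z))).take (tN z).length))
          c (P.w0 (fstP (fstP z))) ∧
        ∀ t, (P.gates (fstP (fstP z))).length ≤ t → t < (tN z).length → c.getD t false = false := by
  classical
  set x₀ := fstP (fstP z) with hx₀
  set tabs := P.tabsOf x₀ (sndP (fstP z)) (fstP (sndP z)) with htabs
  set n := (tN z).length with hn
  set gs := P.gates x₀ with hgs
  have hgsF : (P.F.circ x₀.length).gates = gs := rfl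
  have hw0 : w₀ P.F x₀ = P.w0 x₀ := rfl
  -- the positional form of `ConsG` on the annotated prefix
  have hpos : ConsG (AcSim.annTab tabs (gs.take n)) c (P.w0 x₀) ↔
      ∀ (t k : ℕ) (e : Fin (k + 1) ↪ Fin (P.nq x₀)), t < n → gs[t]? = some (.oracle k e) →
        c.getD t false = (oracleJoin TQBF (tabs t)).boolIndicator (queryOf e (tRunO (gs.take t) c (P.w0 x₀, 0, true)).1) := by
    rw [consG_iff_forall]
    simp only [AcSim.map_fst_annTab, List.take_take, AcSim.getElem?_annTab]
    constructor
    · intro hC t k e ht hg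
      have h := hC t k e (oracleJoin TQBF (tabs t)) (by rw [List.getElem?_take_of_lt ht, hg]; rfl)
      rwa [min_eq_left ht.le] at h
    · intro hC t k e A hg
      by_cases ht : t < n
      · rw [List.getElem?_take_of_lt ht] at hg
        cases hgt : gs[t]? with
        | none => rw [hgt] at hg; exact absurd hg (by simp)
        | some g =>
          rw [hgt, Option.map_some, Option.some.injEq, Prod.mk.injEq] at hg
          obtain ⟨rfl, rfl⟩ := hg
          rw [min_eq_left ht.le]
          exact hC t k e ht hgt
      · rw [List.getElem?_take, if_neg ht] at hg
        exact absurd hg (by simp)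
  -- atoms at round `t`
  have hlive : ∀ t, liveT P.F (boolPair x₀ (boolPair c (encodeNat t))) = [true] ↔ t < gs.length := by
    intro t
    rw [liveT_apply]
    change [decide (t < gs.length)] = [true] ↔ t < gs.length
    simp
  have horc : ∀ t, orcT P.F (boolPair x₀ (boolPair c (encodeNat t))) = [true] ↔ ∃ k e, gs[t]? = some (.oracle k e) := by
    intro t
    rw [orcT_apply]
    change [((gs[t]?).map isOracleB).getD false] = [true] ↔ _
    cases hg : gs[t]? with
    | none => simp
    | some g =>
      cases g with
      | gate op e => simp [isOracleB]
      | oracle k e => exact ⟨fun _ => ⟨k, e, rfl⟩, fun _ => rfl⟩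
  constructor
  · intro hC
    have hC' : ∀ t, t < n → boolPair (boolPair z c) (ones t) ∈ P.ConsBody tN := fun t ht =>
      hC (ones t) (by
        rw [length_ones_eq, eval_add, eval_X]
        have := hb; unfold RoundsBounded at this; omega)
    refine ⟨hpos.2 fun t k e ht hg => ?_, fun t hμ ht => ?_⟩
    · have h := (boolPair_mem_ConsBody_iff z c (ones t)).1 (hC' t ht)
      rw [length_ones_eq] at h
      obtain ⟨htμ, hgt⟩ := List.getElem?_eq_some_iff.1 hg
      have h1 := (h ht).1 ((hlive t).2 htμ) ((horc t).2 ⟨k, e, hg⟩)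
      rw [coinT_apply P.F x₀ c htμ, qryF_apply P.F x₀ c htμ hgt] at h1
      rw [boolIndicator_eq_decide']
      simp only [List.cons.injEq, and_true] at h1
      change c.getD t false = decide (queryOf e (tRunO (gs.take t) c (w₀ P.F x₀, 0, true)).1 ∈ oracleJoin TQBF (tabs t))
      by_cases hq : queryOf e (tRunO (gs.take t) c (w₀ P.F x₀, 0, true)).1 ∈ oracleJoin TQBF (tabs t)
      · rw [decide_eq_true hq]; exact h1.2 hq
      · rw [decide_eq_false hq]
        cases hct : c.getD t false
        · rfl
        · exact absurd (h1.1 hct) hq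
    · have h := (boolPair_mem_ConsBody_iff z c (ones t)).1 (hC' t ht)
      rw [length_ones_eq] at h
      have h2 := (h ht).2 (fun hl => absurd ((hlive t).1 hl) (not_lt.2 hμ))
      cases hct : c.getD t false
      · rfl
      · exact absurd hct h2
  · rintro ⟨hC, hzero⟩ τ _
    rw [boolPair_mem_ConsBody_iff]
    intro ht
    refine ⟨fun hl ho => ?_, fun hl hct => ?_⟩
    · obtain ⟨k, e, hg⟩ := (horc _).1 ho
      obtain ⟨htμ, hgt⟩ := List.getElem?_eq_some_iff.1 hg
      have h := hpos.1 hC τ.length k e ht hg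
      rw [coinT_apply P.F x₀ c htμ, qryF_apply P.F x₀ c htμ hgt, h, boolIndicator_eq_decide']
      change [decide (queryOf e (tRunO (gs.take τ.length) c (w₀ P.F x₀, 0, true)).1 ∈ oracleJoin TQBF (tabs τ.length))] = [true] ↔
        queryOf e (tRunO (gs.take τ.length) c (w₀ P.F x₀, 0, true)).1 ∈ oracleJoin TQBF (tabs τ.length)
      simp
    · have hμ : gs.length ≤ τ.length := not_lt.1 fun h => hl ((hlive _).2 h)
      rw [hzero τ.length hμ ht] at hct
      exact Bool.false_ne_true hct

end Cons

end AcProto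

end Literature.Barriers.QuantumAdvantage

end

/-! ## Part 3 (`AaronsonChenPairSums`): Aaronson–Chen 2017, Lemma 5.3: the path-pair counts, the Hadamard power and the budget of the replaced circuit are `GapNatPSPACE` functions of the advice instance

Machine-level file for the `PSPACE` membership of the physical predicates of the simulator's advice
language ("all the computations can be done in `PSPACE`", [AaronsonChen2017, §5.3 p. 23]). The
integer tests of `AaronsonChenAdviceWeights.lean` (`mem_stageList_iff_linFormTest`,
`sel_iff_linFormTest`) involve four integers attached to an instance `z = ⟨⟨x₀, r⟩, ⟨h, …⟩⟩` and a
round count `n`: the Hadamard power `2^{hCount (gates ↾ n)}`, the budget `a = (|x₀| + T + 2)^c`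
(`T` = number of query gates), and the pair counts `annSetA`/`annSetB` of the annotated replaced
prefix `annTab (tabsOf x₀ r h) (gates ↾ n)` from `w0 x₀` on a set `S` of labels. This file writes
each as a function of `z` in Ladner's gap class `GapNatPSPACE` (`Complexity/GapNatPSpace.lean`):

* counting lemmas: sums over `{0,1}^k` as sums over `Fin k → Bool` (`sum_vector_eq_sum_fin`),
  collapsing a sum over coin strings with a forced zero tail (`sum_vector_zeroTail`), the count
  `#{y ∈ {0,1}^n | y ⊆ H-positions} = 2^{hCount (gs ↾ n)}` (`cnt_sub_hPositions`), and the count of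
  monotone witnesses `#{1^t 0^{L−t} | p t} = #{t ≤ L | p t}` (`cnt_mono`), `sum_orc_eq_oracleQueries`;
* `HZ tN` (`= 2^{hCount (gates ↾ |tN z|)}`, `HZ_mem`, `HZ_apply`), `TZ` (`= T`, `TZ_mem`, `TZ_apply`
  for bounded data), `budZ` (`= bud x₀`, `budZ_mem`, `budZ_apply`);
* the pair-count functions **`AZ tN SM`**, **`BZ tN SM`** — iterated uniform sums, over the two coin
  strings, of the consistency-restricted pair terms read off the prefix atoms
  (`AaronsonChenWalkAtoms.lean`), `SM` a polynomial-time test "the end label is in `S`" —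
  with `AZ_mem`/`BZ_mem` (`GapNatPSPACE`, for a uniform family) and **`AZ_apply`/`BZ_apply`**:
  `AZ z = annSetA (annTab (tabsOf x₀ r h) (gates ↾ n)) (w0 x₀) S` (via `annSetA_eq_sum_consG`,
  `mem_ConsLang_iff`, and the collapse of the coins past the circuit).

No named facts.

## References

* [AaronsonChen2017] arXiv:1612.05903, §5.3 (pp. 22–23), read via `lit read arxiv:1612.05903 --pages 19-25`.
* [AdlemanDeMarraisHuang1997] §6, Lemma 6.10 (pairs of paths), as `OraclePathSums.lean`/`GuessedAnnRuns.lean`.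
* [FennerFortnowKurtz1994] §3 (closure of gap classes), as `GapNatPSpace.lean`.
* [Ladner1989] §1 (`♮PSPACE`).
-/

noncomputable section

namespace Literature.Barriers.QuantumAdvantage

open MeasureTheory _root_.Computability Polynomial Literature.Computability.Complexity
  Literature.Computability.Complexity.Brick Literature.Computability.Complexity.Plumb
  Literature.Computability.Complexity.OracleCompose Literature.Computability.Complexity.PRelSigma
  Literature.Computability.Complexity.TTClosure Literature.Computability.Complexity.StrEq
  Literature.Computability.Cryptography Literature.Computability.QuantumComplexity
  Literature.Computability.QuantumComplexity.ADH
open scoped Classical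

attribute [-simp] Brick.nthF_zero Brick.sndPow_zero

/-! ### Counting lemmas -/

section Counting

variable {M : Type*} [AddCommMonoid M]

/-- A sum over `{0,1}^k` is a sum over `Fin k → Bool`. [folklore] -/
theorem sum_vector_eq_sum_fin (k : ℕ) (f : List Bool → M) :
    ∑ v : List.Vector Bool k, f v.toList = ∑ b : Fin k → Bool, f (List.ofFn b) := by
  refine Fintype.sum_equiv (Equiv.vectorEquivFin Bool k) _ _ fun v => ?_
  change f v.toList = f (List.ofFn v.get)
  rw [← List.Vector.toList_ofFn, List.Vector.ofFn_get]

/-- Transport of a sum over `{0,1}^a` along `a = b`. [folklore] -/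
theorem sum_vector_congr_len {a b : ℕ} (h : a = b) (f : List Bool → M) :
    ∑ v : List.Vector Bool a, f v.toList = ∑ v : List.Vector Bool b, f v.toList := by
  subst h; rfl

/-- **Collapsing a forced zero tail**: summing `F` over the `c ∈ {0,1}^n` whose bits at the positions
`m ≤ t < n` vanish is summing `F (c₁ 0^{n−m})` over `c₁ ∈ {0,1}^m` (`m ≤ n`). [folklore] -/
theorem sum_vector_zeroTail {m n : ℕ} (hmn : m ≤ n) (F : List Bool → M) :
    ∑ c : List.Vector Bool n, (if ∀ t, m ≤ t → t < n → c.toList.getD t false = false then F c.toList else 0) =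
      ∑ c₁ : List.Vector Bool m, F (c₁.toList ++ List.replicate (n - m) false) := by
  -- the embedding `c₁ ↦ c₁ 0^{n-m}`
  let e : List.Vector Bool m ↪ List.Vector Bool n :=
    ⟨fun c₁ => ⟨c₁.toList ++ List.replicate (n - m) false, by simp; omega⟩, fun c₁ c₂ h => by
      have h' := congrArg List.Vector.toList h
      exact List.Vector.eq _ _ (List.append_inj_left h' (by simp))⟩
  have he : ∀ c₁ : List.Vector Bool m, (e c₁).toList = c₁.toList ++ List.replicate (n - m) false := fun _ => rfl
  have htail : ∀ c : List.Vector Bool n, (∀ t, m ≤ t → t < n → c.toList.getD t false = false) ↔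
      c ∈ Finset.univ.map e := by
    intro c
    constructor
    · intro h
      refine Finset.mem_map.2 ⟨⟨c.toList.take m, by simp; omega⟩, Finset.mem_univ _, ?_⟩
      apply List.Vector.eq
      rw [he]
      apply List.ext_getElem
      · simp; omega
      · intro i h1 h2
        simp only [List.Vector.toList_length] at h2
        by_cases him : i < m
        · rw [List.getElem_append_left (by simp; omega)]
          simp
        · rw [List.getElem_append_right (by simp; omega), List.getElem_replicate]
          have h3 := h i (not_lt.1 him) h2
          rw [List.getD_eq_getElem?_getD, List.getElem?_eq_getElem (by simpa using h2), Option.getD_some] at h3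
          exact h3.symm
    · intro h t hmt htn
      obtain ⟨c₁, -, rfl⟩ := Finset.mem_map.1 h
      rw [he, List.getD_eq_getElem?_getD, List.getElem?_append_right (by simp; omega), List.getElem?_replicate]
      simp only [List.Vector.toList_length]
      rw [if_pos (by omega)]
      rfl
  calc ∑ c : List.Vector Bool n, (if ∀ t, m ≤ t → t < n → c.toList.getD t false = false then F c.toList else 0)
      = ∑ c ∈ Finset.univ.map e, (if ∀ t, m ≤ t → t < n → c.toList.getD t false = false then F c.toList else 0) := by
        symm
        refine Finset.sum_subset (Finset.subset_univ _) fun c _ hc => ?_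
        rw [if_neg (fun h => hc ((htail c).1 h))]
    _ = ∑ c₁ : List.Vector Bool m, (if ∀ t, m ≤ t → t < n → (e c₁).toList.getD t false = false then F (e c₁).toList else 0) :=
        Finset.sum_map _ _ _
    _ = ∑ c₁ : List.Vector Bool m, F (c₁.toList ++ List.replicate (n - m) false) := by
        refine Finset.sum_congr rfl fun c₁ _ => ?_
        rw [if_pos ((htail _).2 (Finset.mem_map_of_mem _ (Finset.mem_univ _))), he]

/-- The collapse for a summand given on lists of length `n`. [folklore] -/
theorem sum_vector_zeroTail' {m n : ℕ} (hmn : m ≤ n) (g F : List Bool → M)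
    (hg : ∀ l : List Bool, l.length = n → g l = if ∀ t, m ≤ t → t < n → l.getD t false = false then F l else 0) :
    ∑ c : List.Vector Bool n, g c.toList = ∑ c₁ : List.Vector Bool m, F (c₁.toList ++ List.replicate (n - m) false) := by
  rw [← sum_vector_zeroTail hmn F]
  exact Finset.sum_congr rfl fun c _ => hg _ (by simp)

/-- **Subsets of the Hadamard positions**: among `y ∈ {0,1}^n`, those whose set bits are at positions
`t < n` holding a Hadamard gate number `2^{hCount (gs ↾ n)}`. [folklore] -/
theorem cnt_sub_hPositions {N : ℕ} : ∀ (gs : List (QGate cliffordT N)) (n : ℕ),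
    cnt n {y : List Bool | ∀ t < n, y.getD t false = true → ((gs[t]?).map QGateIsH).getD false = true} = 2 ^ hCount (gs.take n)
  | [], n => by
    rw [List.take_nil, hCount_nil, pow_zero, ← PPSharpP.cnt_noTrue n]
    refine cnt_congr fun y hy => ?_
    simp only [List.getElem?_nil, Option.map_none, Option.getD_none, Bool.false_eq_true, imp_false, Set.mem_setOf_eq]
    constructor
    · intro h ht
      obtain ⟨i, hi, hyi⟩ := List.getElem_of_mem ht
      exact h i (hy ▸ hi) (by rw [List.getD_eq_getElem?_getD, List.getElem?_eq_getElem hi]; simpa using hyi)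
    · intro h t _ hyt
      apply h
      rw [List.getD_eq_getElem?_getD] at hyt
      cases hg : y[t]? with
      | none => rw [hg] at hyt; exact absurd hyt (by simp)
      | some b => rw [hg] at hyt; simp only [Option.getD_some] at hyt; subst hyt; exact List.mem_of_getElem? hg
  | g :: gs, 0 => by
    have hnil : ([] : List Bool) ∈ {y : List Bool | ∀ t < 0, y.getD t false = true → (((g :: gs)[t]?).map QGateIsH).getD false = true} := by
      simp
    rw [List.take_zero, hCount_nil, pow_zero, cnt_zero, if_pos hnil]
  | g :: gs, n + 1 => by
    rw [cnt_succ, List.take_succ_cons, hCount_cons, pow_add]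
    have h0 : cnt n {v : List Bool | false :: v ∈ {y : List Bool | ∀ t < n + 1, y.getD t false = true →
        (((g :: gs)[t]?).map QGateIsH).getD false = true}} =
        cnt n {y : List Bool | ∀ t < n, y.getD t false = true → ((gs[t]?).map QGateIsH).getD false = true} := by
      refine cnt_congr fun v _ => ?_
      simp only [Set.mem_setOf_eq]
      constructor
      · intro h t ht hv; exact h (t + 1) (by omega) (by simpa using hv)
      · intro h t ht hv
        cases t with
        | zero => simp at hv
        | succ t => exact h t (by omega) (by simpa using hv)
    have h1 : cnt n {v : List Bool | true :: v ∈ {y : List Bool | ∀ t < n + 1, y.getD t false = true →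
        (((g :: gs)[t]?).map QGateIsH).getD false = true}} =
        if QGateIsH g then cnt n {y : List Bool | ∀ t < n, y.getD t false = true → ((gs[t]?).map QGateIsH).getD false = true} else 0 := by
      split_ifs with hg
      · refine cnt_congr fun v _ => ?_
        simp only [Set.mem_setOf_eq]
        constructor
        · intro h t ht hv; exact h (t + 1) (by omega) (by simpa using hv)
        · intro h t ht hv
          cases t with
          | zero => simpa using hg
          | succ t => exact h t (by omega) (by simpa using hv)
      · have hempty : cnt n (∅ : Set (List Bool)) = 0 := by
          have h := cnt_add_cnt_compl n (∅ : Set (List Bool))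
          rw [Set.compl_empty, cnt_univ] at h
          omega
        refine Eq.trans (cnt_congr fun v _ => ?_) hempty
        simp only [Set.mem_setOf_eq, Set.mem_empty_iff_false, iff_false]
        intro h
        have := h 0 (by omega) (by simp)
        simp [hg] at this
    rw [h0, h1, cnt_sub_hPositions gs n]
    split_ifs <;> ring

/-- The monotone strings `1^t 0^*`. [folklore] -/
def IsMono (y : List Bool) : Prop := y = ones (y.count true) ++ List.replicate (y.length - y.count true) false

/-- `0v` is monotone iff `v` has no `1`. [folklore] -/
theorem isMono_false_cons (v : List Bool) : IsMono (false :: v) ↔ true ∉ v := by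
  unfold IsMono
  rw [List.count_cons_of_ne (by decide)]
  constructor
  · intro h ht
    cases hc : v.count true with
    | zero => exact (List.count_eq_zero.1 hc) ht
    | succ k => rw [hc, ones, List.replicate_succ, List.cons_append] at h; exact absurd (List.cons.inj h).1 (by decide)
  · intro h
    rw [List.count_eq_zero.2 h, ones, List.replicate_zero, List.nil_append, List.length_cons, Nat.sub_zero, List.replicate_succ]
    congr 1
    exact (List.eq_replicate_iff.2 ⟨rfl, fun b hb => by cases b <;> [rfl; exact absurd hb h]⟩)

/-- `1v` is monotone iff `v` is. [folklore] -/
theorem isMono_true_cons (v : List Bool) : IsMono (true :: v) ↔ IsMono v := by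
  simp only [IsMono, List.count_cons_self, List.length_cons, Nat.succ_sub_succ, ones, List.replicate_succ, List.cons_append,
    List.cons.injEq, true_and]

/-- **Counting monotone witnesses**: among `y ∈ {0,1}^L` the monotone ones whose number of `1`s
satisfies `p` are as many as the `t ≤ L` with `p t`. [folklore] -/
theorem cnt_mono (p : ℕ → Prop) : ∀ L : ℕ,
    cnt L {y : List Bool | IsMono y ∧ p (y.count true)} = ((List.range (L + 1)).filter fun t => p t).length
  | 0 => by
    rw [cnt_zero, List.range_succ, List.range_zero, List.nil_append, List.filter_singleton]
    have hm : IsMono [] := by simp [IsMono, ones]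
    by_cases hp : p 0 <;> simp [hm, hp]
  | L + 1 => by
    rw [cnt_succ]
    have h0 : cnt L {v : List Bool | false :: v ∈ {y : List Bool | IsMono y ∧ p (y.count true)}} = if p 0 then 1 else 0 := by
      have hset : ∀ v : List Bool, (false :: v ∈ {y : List Bool | IsMono y ∧ p (y.count true)}) ↔ (true ∉ v ∧ p 0) := by
        intro v
        simp only [Set.mem_setOf_eq, isMono_false_cons, List.count_cons, beq_iff_eq, Bool.false_eq_true, if_false, Nat.add_zero]
        constructor
        · rintro ⟨h, hp⟩; exact ⟨h, by rwa [List.count_eq_zero.2 h] at hp⟩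
        · rintro ⟨h, hp⟩; exact ⟨h, by rwa [List.count_eq_zero.2 h]⟩
      split_ifs with hp
      · rw [← PPSharpP.cnt_noTrue L]
        exact cnt_congr fun v _ => by rw [Set.mem_setOf_eq, hset]; simp [hp]
      · have hempty : cnt L (∅ : Set (List Bool)) = 0 := by
          have h := cnt_add_cnt_compl L (∅ : Set (List Bool))
          rw [Set.compl_empty, cnt_univ] at h
          omega
        exact Eq.trans (cnt_congr fun v _ => by rw [Set.mem_setOf_eq, hset]; simp [hp]) hempty
    have h1 : cnt L {v : List Bool | true :: v ∈ {y : List Bool | IsMono y ∧ p (y.count true)}} =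
        cnt L {y : List Bool | IsMono y ∧ p (y.count true + 1)} :=
      cnt_congr fun v _ => by simp only [Set.mem_setOf_eq, isMono_true_cons, List.count_cons_self]
    rw [h0, h1, cnt_mono (fun t => p (t + 1)) L, List.range_succ_eq_map (n := L + 1), List.filter_cons, List.filter_map]
    have hf : ((List.range (L + 1)).filter ((fun t => decide (p t)) ∘ Nat.succ)).length =
        ((List.range (L + 1)).filter fun t => decide (p (t + 1))).length := rfl
    by_cases hp : p 0
    · rw [if_pos hp, if_pos (decide_eq_true hp), List.length_cons, List.length_map, hf]; omega
    · rw [if_neg hp, if_neg (by simpa using hp), List.length_map, hf]; omega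

/-- The number of query gates as a count over positions. [cite: BernsteinVazirani1997, §8] -/
theorem oracleQueries_eq_length_filter_orc {N : ℕ} : ∀ (gs : List (QGate cliffordT N)) (L : ℕ), gs.length ≤ L + 1 →
    (⟨gs⟩ : QCircuit cliffordT N).oracleQueries = ((List.range (L + 1)).filter fun t => ((gs[t]?).map isOracleB).getD false).length
  | [], L, _ => by
    rw [show (⟨[]⟩ : QCircuit cliffordT N).oracleQueries = 0 from rfl]
    symm
    simp
  | g :: gs, L, h => by
    have hstep : (⟨g :: gs⟩ : QCircuit cliffordT N).oracleQueries = (⟨gs⟩ : QCircuit cliffordT N).oracleQueries + (if isOracleB g then 1 else 0) := by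
      unfold QCircuit.oracleQueries
      cases g with
      | gate op e => simp [QGate.IsOracleFree, isOracleB]
      | oracle k e => simp [QGate.IsOracleFree, isOracleB]
    cases L with
    | zero =>
      have hgs : gs = [] := List.eq_nil_of_length_eq_zero (by simp only [List.length_cons] at h; omega)
      subst hgs
      rw [hstep, show (⟨[]⟩ : QCircuit cliffordT N).oracleQueries = 0 from rfl, Nat.zero_add]
      cases hb : isOracleB g <;> simp [hb, List.range_succ]
    | succ L =>
      have ih := oracleQueries_eq_length_filter_orc gs L (by simpa using h)
      rw [hstep, ih, List.range_succ_eq_map (n := L + 1), List.filter_cons, List.filter_map]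
      have hf : ((List.range (L + 1)).filter ((fun t => (((g :: gs)[t]?).map isOracleB).getD false) ∘ Nat.succ)).length =
          ((List.range (L + 1)).filter fun t => ((gs[t]?).map isOracleB).getD false).length := rfl
      by_cases hg : isOracleB g = true
      · rw [if_pos hg, if_pos (by simpa using hg), List.length_cons, List.length_map, hf]
      · rw [if_neg hg, if_neg (by simpa using hg), List.length_map, hf]
        try omega

end Counting

/-! ### The Hadamard power, the query count and the budget as gap functions -/

namespace AcProto

variable (P : AcProto) (tN : List Bool → List Bool)

/-- The input `x₀` read off `z = ⟨⟨x₀, r⟩, …⟩`. [folklore] -/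
abbrev x0Z : List Bool → List Bool := fstP ∘ fstP

/-- The body of the Hadamard-position relation on `⟨⟨z, y⟩, τ⟩`: if `|τ| < |tN z|` and bit `|τ|` of `y`
is set then gate `|τ|` is a Hadamard gate. [folklore] -/
def HBody : Language Bool :=
  {q | (tauY q).length < (tN (zY q)).length → (cY q).getD (tauY q).length false = true → (hadT P.F ∘ atomArg) q = [true]}

/-- The Hadamard-position relation on `⟨z, y⟩`. [folklore] -/
def HRel : Language Bool := {v | ∀ τ : List Bool, τ.length ≤ (X : Polynomial ℕ).eval v.length → boolPair v τ ∈ P.HBody tN}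

/-- **The Hadamard power** `HZ z = #{y ∈ {0,1}^{|tN z|} | ⟨z, y⟩ ∈ HRel}` (`= 2^{hCount (gates ↾ |tN z|)}`).
[cite: AdlemanDeMarraisHuang1997, §6 Lemma 6.10 (the normalisation 2^h)] -/
def HZ (z : List Bool) : ℕ := cnt (tN z).length {y | boolPair z y ∈ P.HRel tN}

variable {P tN} in
/-- `HZ ∈ ♮PSPACE` for a uniform family and `tN ∈ FP`. [cite: Ladner1989, §1 (♮PSPACE)] -/
theorem HZ_mem (hU : P.F.IsUniform) (htN : tN ∈ FP) : P.HZ tN ∈ NatPSPACE := by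
  obtain ⟨-, -, -, -, -, -, hhad, -, -, -⟩ := atoms_mem_FP hU
  have hG : ({q | (tauY q).length < (tN (zY q)).length} : Language Bool) ∈ Classes.P :=
    mem_P_of_iff (preimage_mem_P (LenLt_mem_P X) (pairFn_mem_FP (comp_mem_FP htN (comp_mem_FP fstP_mem_FP fstP_mem_FP)) sndP_mem_FP))
      _ fun y => by rw [memL_preimage, pairFn_apply, boolPair_mem_LenLt, eval_X]; rfl
  have hZ : ({q | (cY q).getD (tauY q).length false = true} : Language Bool) ∈ Classes.P :=
    setOf_getD_mem_P sndP_mem_FP (comp_mem_FP sndP_mem_FP fstP_mem_FP)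
  have hH : ({q | (hadT P.F ∘ atomArg) q = [true]} : Language Bool) ∈ Classes.P :=
    setOf_apply_eq_apply_mem_P (comp_mem_FP hhad atomArg_mem_FP) (const_mem_FP _)
  have hbody : P.HBody tN ∈ Classes.P := by
    have h := union_mem_P ((compl_mem_P_iff).2 hG) (union_mem_P ((compl_mem_P_iff).2 hZ) hH)
    refine mem_P_of_iff h _ fun q => ?_
    rw [StockMachine.memL_sup, StockMachine.memL_sup, PPSharpP.memL_compl, PPSharpP.memL_compl]
    change (_ → _ → _) ↔ _
    simp only [imp_iff_not_or]
    exact Iff.rfl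
  exact count_mem_NatPSPACE (polyForall_mem_PSPACE (P_subset_PSPACE_holds hbody) X) htN

/-- **Value of `HZ`**: `2^{hCount (gates ↾ |tN z|)}`. [cite: AdlemanDeMarraisHuang1997, §6 Lemma 6.10] -/
theorem HZ_apply (z : List Bool) : P.HZ tN z = 2 ^ hCount ((P.gates (x0Z z)).take (tN z).length) := by
  unfold HZ
  rw [← cnt_sub_hPositions (P.gates (x0Z z)) (tN z).length]
  refine cnt_congr fun y hy => ?_
  simp only [Set.mem_setOf_eq, HRel, StockMachine.memL_setOf, eval_X]
  have hbody : ∀ τ : List Bool, boolPair (boolPair z y) τ ∈ P.HBody tN ↔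
      (τ.length < (tN z).length → y.getD τ.length false = true →
        (((P.gates (x0Z z))[τ.length]?).map QGateIsH).getD false = true) := by
    intro τ
    unfold HBody
    rw [StockMachine.memL_setOf]
    simp only [Function.comp_apply, atomArg_boolPair, hadT_apply]
    simp only [fstP_boolPair, sndP_boolPair, List.cons.injEq, and_true]
    exact Iff.rfl
  simp only [hbody]
  constructor
  · intro h t ht hyt
    have h' := h (ones t) (by rw [length_ones_eq, length_boolPair]; omega)
    rw [length_ones_eq] at h'
    exact h' ht hyt
  · intro h τ _ ht hyt
    exact h τ.length ht hyt

/-- The monotone-witness relation on `⟨z, y⟩`: `y = 1^t 0^*` and gate `t` of the circuit of `x₀` is a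
query gate. [folklore] -/
def TRel : Language Bool :=
  ({v | sndP v = (concatFn ∘ pairFn (binToUnaryFn ∘ pairFn sndP (HashBricks.popCountFn ∘ sndP))
      (Kannan.zerosFn ∘ dropFn ∘ pairFn (binToUnaryFn ∘ pairFn sndP (HashBricks.popCountFn ∘ sndP)) sndP)) v} : Language Bool) ⊓
    ({v | (orcT P.F ∘ pairFn (x0Z ∘ fstP) (pairFn (fun _ => []) (HashBricks.popCountFn ∘ sndP))) v = [true]} : Language Bool)

/-- **The query count** `TZ z = #{y ∈ {0,1}^{pF(|x₀|)} | ⟨z, y⟩ ∈ TRel}` (`= T`, the number of query gates).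
[cite: AaronsonChen2017, §5.3 (p. 22, "poly(n, 1/ε) queries")] -/
def TZ (z : List Bool) : ℕ := cnt (P.pF.eval (x0Z z).length) {y | boolPair z y ∈ P.TRel}

variable {P} in
/-- `TZ ∈ ♮PSPACE` (indeed `#P`) for a uniform family. [cite: Ladner1989, §1 (♮PSPACE)] -/
theorem TZ_mem (hU : P.F.IsUniform) : P.TZ ∈ NatPSPACE := by
  obtain ⟨-, -, -, -, -, horc, -, -, -, -⟩ := atoms_mem_FP hU
  have hbu : (binToUnaryFn ∘ pairFn sndP (HashBricks.popCountFn ∘ sndP)) ∈ FP :=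
    comp_mem_FP binToUnaryFn_mem_FP (pairFn_mem_FP sndP_mem_FP (comp_mem_FP HashBricks.popCountFn_mem_FP sndP_mem_FP))
  have h1 : ({v | sndP v = (concatFn ∘ pairFn (binToUnaryFn ∘ pairFn sndP (HashBricks.popCountFn ∘ sndP))
      (Kannan.zerosFn ∘ dropFn ∘ pairFn (binToUnaryFn ∘ pairFn sndP (HashBricks.popCountFn ∘ sndP)) sndP)) v} : Language Bool) ∈ Classes.P :=
    setOf_apply_eq_apply_mem_P sndP_mem_FP (comp_mem_FP concatFn_mem_FP (pairFn_mem_FP hbu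
      (comp_mem_FP Kannan.zerosFn_mem_FP (comp_mem_FP dropFn_mem_FP (pairFn_mem_FP hbu sndP_mem_FP)))))
  have h2 : ({v | (orcT P.F ∘ pairFn (x0Z ∘ fstP) (pairFn (fun _ => []) (HashBricks.popCountFn ∘ sndP))) v = [true]} : Language Bool) ∈ Classes.P :=
    setOf_apply_eq_apply_mem_P (comp_mem_FP horc (pairFn_mem_FP (comp_mem_FP (comp_mem_FP fstP_mem_FP fstP_mem_FP) fstP_mem_FP)
      (pairFn_mem_FP (const_mem_FP _) (comp_mem_FP HashBricks.popCountFn_mem_FP sndP_mem_FP)))) (const_mem_FP _)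
  have hT : P.TRel ∈ PSPACE := P_subset_PSPACE_holds (inter_mem_P h1 h2)
  have h := count_mem_NatPSPACE hT (comp_mem_FP (polyFn_mem_FP P.pF) (comp_mem_FP fstP_mem_FP fstP_mem_FP))
  refine (show (fun v => cnt ((polyFn P.pF ∘ x0Z) v).length {y | boolPair v y ∈ P.TRel}) = P.TZ from funext fun v => ?_) ▸ h
  simp [TZ]

/-- Membership in `TRel`. [folklore] -/
theorem boolPair_mem_TRel_iff (z y : List Bool) :
    boolPair z y ∈ P.TRel ↔ IsMono y ∧ (((P.gates (x0Z z))[y.count true]?).map isOracleB).getD false = true := by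
  unfold TRel
  rw [StockMachine.memL_inf, StockMachine.memL_setOf, StockMachine.memL_setOf]
  simp only [Function.comp_apply, pairFn_apply, sndP_boolPair, fstP_boolPair, HashBricks.popCountFn_apply, binToUnaryFn_boolPair,
    bitsToNat_encodeNat, concatFn_boolPair, Kannan.zerosFn_apply, dropFn_boolPair, List.length_drop, length_ones_eq, orcT_apply,
    List.cons.injEq, and_true]
  rw [min_eq_left (List.count_le_length)]
  exact Iff.rfl

variable {P} in
/-- **Value of `TZ`** for bounded data: the number `T` of query gates of the circuit of `x₀`.
[cite: AaronsonChen2017, §5.3 (p. 22)] -/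
theorem TZ_apply (hP : P.IsBounded) (z : List Bool) : P.TZ z = (P.F.circ (x0Z z).length).oracleQueries := by
  unfold TZ
  have hμ : (P.gates (x0Z z)).length ≤ P.pF.eval (x0Z z).length + 1 := ((hP.size_le _).1).trans (Nat.le_succ _)
  rw [show (P.F.circ (x0Z z).length).oracleQueries = (⟨P.gates (x0Z z)⟩ : QCircuit cliffordT (P.nq (x0Z z))).oracleQueries from rfl,
    oracleQueries_eq_length_filter_orc (P.gates (x0Z z)) _ hμ]
  refine (cnt_congr fun y _ => P.boolPair_mem_TRel_iff z y).trans
    ((cnt_mono (fun t => (((P.gates (x0Z z))[t]?).map isOracleB).getD false = true) _).trans ?_)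
  congr 1
  exact List.filter_congr fun t _ => by simp

/-- **The budget** `a = (|x₀| + T + 2)^c` as an integer function of `z`. [cite: AaronsonChen2017, §5.3 (p. 22)] -/
def budZ (z : List Bool) : ℤ := (((x0Z z).length : ℤ) + (P.TZ z : ℤ) + 2) ^ P.c

variable {P} in
/-- `budZ ∈ GapNatPSPACE` for a uniform family. [cite: FennerFortnowKurtz1994, §3] -/
theorem budZ_mem (hU : P.F.IsUniform) : P.budZ ∈ GapNatPSPACE := by
  have hlen : (fun z => ((x0Z z).length : ℤ)) ∈ GapNatPSPACE := by
    have h := natFP_mem_GapNatPSPACE (comp_mem_FP lenBinF_mem_FP (comp_mem_FP fstP_mem_FP fstP_mem_FP))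
    refine (show (fun x => (bitsToNat ((lenBinF ∘ fstP ∘ fstP) x) : ℤ)) = fun z => ((x0Z z).length : ℤ) from funext fun z => ?_) ▸ h
    simp
  exact pow_mem_GapNatPSPACE (add_mem_GapNatPSPACE (add_mem_GapNatPSPACE hlen (natPSPACE_mem_GapNatPSPACE (TZ_mem hU)))
    (const_mem_GapNatPSPACE 2)) P.c

variable {P} in
/-- **Value of `budZ`** for bounded data: `bud x₀`. [cite: AaronsonChen2017, §5.3 (p. 22)] -/
theorem budZ_apply (hP : P.IsBounded) (z : List Bool) : P.budZ z = (P.bud (x0Z z) : ℤ) := by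
  unfold budZ bud acSimParam
  rw [TZ_apply hP]
  push_cast
  rfl

/-! ### The pair counts as gap functions -/

section Pairs

variable (SM : Language Bool)

/-- Accessors on `y₂ = ⟨⟨z, c⟩, c'⟩`: the instance. [folklore] -/
abbrev zW : List Bool → List Bool := fstP ∘ fstP
/-- The first coin string `c`. [folklore] -/
abbrev cW : List Bool → List Bool := sndP ∘ fstP
/-- The second coin string `c'`. [folklore] -/
abbrev c'W : List Bool → List Bool := sndP

/-- The atom argument `⟨x₀, ⟨c, bin n⟩⟩` of the end of the first walk (`n = |tN z|`). [folklore] -/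
def argE : List Bool → List Bool := pairFn (x0Z ∘ zW) (pairFn cW (lenBinF ∘ tN ∘ zW))
/-- The atom argument `⟨x₀, ⟨c', bin n⟩⟩` of the end of the second walk. [folklore] -/
def argE' : List Bool → List Bool := pairFn (x0Z ∘ zW) (pairFn c'W (lenBinF ∘ tN ∘ zW))

/-- The end arguments are in `FP`. [folklore] -/
theorem argE_mem_FP (htN : tN ∈ FP) : argE tN ∈ FP ∧ argE' tN ∈ FP :=
  ⟨pairFn_mem_FP (comp_mem_FP (comp_mem_FP fstP_mem_FP fstP_mem_FP) (comp_mem_FP fstP_mem_FP fstP_mem_FP))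
    (pairFn_mem_FP (comp_mem_FP sndP_mem_FP fstP_mem_FP) (comp_mem_FP lenBinF_mem_FP (comp_mem_FP htN (comp_mem_FP fstP_mem_FP fstP_mem_FP)))),
   pairFn_mem_FP (comp_mem_FP (comp_mem_FP fstP_mem_FP fstP_mem_FP) (comp_mem_FP fstP_mem_FP fstP_mem_FP))
    (pairFn_mem_FP sndP_mem_FP (comp_mem_FP lenBinF_mem_FP (comp_mem_FP htN (comp_mem_FP fstP_mem_FP fstP_mem_FP))))⟩

/-- Values of the end arguments. [folklore] -/
theorem argE_boolPair (z c c' : List Bool) :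
    argE tN (boolPair (boolPair z c) c') = boolPair (fstP (fstP z)) (boolPair c (encodeNat (tN z).length)) ∧
    argE' tN (boolPair (boolPair z c) c') = boolPair (fstP (fstP z)) (boolPair c' (encodeNat (tN z).length)) := by
  constructor <;> simp [argE, argE']

/-- **The geometric condition** of the pair term: both walks valid, same end label, end label in `S`.
[cite: AdlemanDeMarraisHuang1997, §6 Lemma 6.10] -/
def Cond : Language Bool :=
  {y | (AcWalk.pvldT P.F ∘ argE tN) y = [true] ∧ (AcWalk.pvldT P.F ∘ argE' tN) y = [true] ∧
    (AcWalk.plabF P.F ∘ argE tN) y = (AcWalk.plabF P.F ∘ argE' tN) y ∧ y ∈ SM}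

/-- **The phase-class condition** `φ ≡ φ' + k (mod 8)`. [cite: AdlemanDeMarraisHuang1997, §6 Lemma 6.10] -/
def Dk (k : ℕ) : Language Bool := {y | (AcWalk.pphkF P.F 0 ∘ argE tN) y = (AcWalk.pphkF P.F k ∘ argE' tN) y}

/-- Both coin strings are consistent. [cite: AaronsonChen2017, §5.3 (p. 23)] -/
def ConsPair : Language Bool := (fstP ⁻¹' P.ConsLang tN : Language Bool) ⊓ (pairFn zW c'W ⁻¹' P.ConsLang tN : Language Bool)

/-- The indicator of a language as an integer function. [folklore] -/
def ind (A : Language Bool) (y : List Bool) : ℤ := if y ∈ A then 1 else 0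

/-- **The `A`-part pair term** `[Cond ∧ d = 0] − [Cond ∧ d = 4]`. [cite: AdlemanDeMarraisHuang1997, §6 Lemma 6.10] -/
def termA (y : List Bool) : ℤ := ind (P.Cond tN SM ⊓ P.Dk tN 0) y - ind (P.Cond tN SM ⊓ P.Dk tN 4) y

/-- **The `B`-part pair term** `[Cond ∧ d ∈ {1,7}] − [Cond ∧ d ∈ {3,5}]`. [cite: AdlemanDeMarraisHuang1997, §6 Lemma 6.10] -/
def termB (y : List Bool) : ℤ :=
  (ind (P.Cond tN SM ⊓ P.Dk tN 1) y + ind (P.Cond tN SM ⊓ P.Dk tN 7) y) -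
    (ind (P.Cond tN SM ⊓ P.Dk tN 3) y + ind (P.Cond tN SM ⊓ P.Dk tN 5) y)

/-- The consistency-restricted `A`-term. [folklore] -/
def GA (y : List Bool) : ℤ := if y ∈ P.ConsPair tN then P.termA tN SM y else 0
/-- The consistency-restricted `B`-term. [folklore] -/
def GB (y : List Bool) : ℤ := if y ∈ P.ConsPair tN then P.termB tN SM y else 0

/-- The inner sum over the second coin string. [folklore] -/
def innerA (v : List Bool) : ℤ := ∑ c' : List.Vector Bool (tN (fstP v)).length, P.GA tN SM (boolPair v c'.toList)
/-- The inner sum over the second coin string (`B`-part). [folklore] -/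
def innerB (v : List Bool) : ℤ := ∑ c' : List.Vector Bool (tN (fstP v)).length, P.GB tN SM (boolPair v c'.toList)

/-- **The `A`-part pair count as a function of the instance**: the iterated uniform sum of `GA`.
[cite: AaronsonChen2017, §5.3 (p. 23, "all the computations can be done in PSPACE")] -/
def AZ (z : List Bool) : ℤ := ∑ c : List.Vector Bool (tN z).length, P.innerA tN SM (boolPair z c.toList)
/-- **The `B`-part pair count as a function of the instance.** [cite: AaronsonChen2017, §5.3 (p. 23)] -/
def BZ (z : List Bool) : ℤ := ∑ c : List.Vector Bool (tN z).length, P.innerB tN SM (boolPair z c.toList)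

/-- The indicator of a `PSPACE` language is a gap function. [cite: FennerFortnowKurtz1994, §3] -/
theorem ind_mem {A : Language Bool} (hA : A ∈ PSPACE) : ind A ∈ GapNatPSPACE :=
  ite_mem_GapNatPSPACE (const_mem_GapNatPSPACE 1) hA

variable {SM}

/-- `Cond`, `Dk` are in `P` (for a uniform family, `tN ∈ FP`, `SM ∈ P`). [cite: AroraBarak2009, §1.3] -/
theorem cond_Dk_mem_P (hU : P.F.IsUniform) (htN : tN ∈ FP) (hSM : SM ∈ Classes.P) :
    P.Cond tN SM ∈ Classes.P ∧ ∀ k, P.Dk tN k ∈ Classes.P := by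
  obtain ⟨hv, hl, hph⟩ := AcWalk.patoms_mem_FP hU
  obtain ⟨ha, ha'⟩ := argE_mem_FP tN htN
  have hbit : ∀ {f : List Bool → List Bool}, f ∈ FP → ({y | f y = [true]} : Language Bool) ∈ Classes.P := fun hf =>
    setOf_apply_eq_apply_mem_P hf (const_mem_FP _)
  refine ⟨?_, fun k => setOf_apply_eq_apply_mem_P (comp_mem_FP (hph 0) ha) (comp_mem_FP (hph k) ha')⟩
  have h := inter_mem_P (hbit (comp_mem_FP hv ha)) (inter_mem_P (hbit (comp_mem_FP hv ha'))
    (inter_mem_P (setOf_apply_eq_apply_mem_P (comp_mem_FP hl ha) (comp_mem_FP hl ha')) hSM))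
  refine mem_P_of_iff h _ fun y => ?_
  rw [StockMachine.memL_inf, StockMachine.memL_inf, StockMachine.memL_inf]
  exact Iff.rfl

/-- **`GA`, `GB ∈ GapNatPSPACE`.** [cite: FennerFortnowKurtz1994, §3] -/
theorem GA_GB_mem (hU : P.F.IsUniform) (htN : tN ∈ FP) (hSM : SM ∈ Classes.P) :
    P.GA tN SM ∈ GapNatPSPACE ∧ P.GB tN SM ∈ GapNatPSPACE := by
  obtain ⟨B, hB⟩ := exists_isComplete_PSPACE_holds
  obtain ⟨hcond, hD⟩ := P.cond_Dk_mem_P tN hU htN hSM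
  have hcons : P.ConsPair tN ∈ PSPACE :=
    inter_mem_PSPACE_of_complete hB (preimage_mem_PSPACE (ConsLang_mem_PSPACE hU htN) fstP_mem_FP)
      (preimage_mem_PSPACE (ConsLang_mem_PSPACE hU htN) (pairFn_mem_FP (comp_mem_FP fstP_mem_FP fstP_mem_FP) sndP_mem_FP))
  have hI : ∀ k, ind (P.Cond tN SM ⊓ P.Dk tN k) ∈ GapNatPSPACE := fun k =>
    ind_mem (P_subset_PSPACE_holds (inter_mem_P hcond (hD k)))
  have hA : P.termA tN SM ∈ GapNatPSPACE := sub_mem_GapNatPSPACE (hI 0) (hI 4)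
  have hBt : P.termB tN SM ∈ GapNatPSPACE :=
    sub_mem_GapNatPSPACE (add_mem_GapNatPSPACE (hI 1) (hI 7)) (add_mem_GapNatPSPACE (hI 3) (hI 5))
  exact ⟨ite_mem_GapNatPSPACE hA hcons, ite_mem_GapNatPSPACE hBt hcons⟩

/-- **`AZ`, `BZ ∈ GapNatPSPACE`** (two uniform exponential sums). [cite: FennerFortnowKurtz1994, §3 (closure under uniform sums)] -/
theorem AZ_BZ_mem (hU : P.F.IsUniform) (htN : tN ∈ FP) (hSM : SM ∈ Classes.P) :
    P.AZ tN SM ∈ GapNatPSPACE ∧ P.BZ tN SM ∈ GapNatPSPACE := by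
  obtain ⟨hA, hB⟩ := P.GA_GB_mem tN hU htN hSM
  have ht1 : tN ∘ fstP ∈ FP := comp_mem_FP htN fstP_mem_FP
  exact ⟨sum_mem_GapNatPSPACE (sum_mem_GapNatPSPACE hA ht1) htN, sum_mem_GapNatPSPACE (sum_mem_GapNatPSPACE hB ht1) htN⟩

variable (SM)

/-! ### The values of the pair counts -/

/-- The end state of a walk of `n = |tN z|` gates with coins `c` from `w0 x₀`, `x₀ = fstP (fstP z)`. [folklore] -/
abbrev est (z c : List Bool) : TState (P.nq (fstP (fstP z))) :=
  tRunO ((P.gates (fstP (fstP z))).take (tN z).length) c (P.w0 (fstP (fstP z)), 0, true)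

/-- The prefix state of the atoms is `est` (definitional). [folklore] -/
theorem pst_eq_est (z c : List Bool) : AcWalk.pst P.F (fstP (fstP z)) c (tN z).length = P.est tN z c := rfl

/-- **Membership in `Cond` and `Dk` on the intended arguments.** [folklore] -/
theorem mem_cond_Dk_iff (z c c' : List Bool) :
    (boolPair (boolPair z c) c' ∈ P.Cond tN SM ↔
      (P.est tN z c).2.2 = true ∧ (P.est tN z c').2.2 = true ∧ (P.est tN z c).1 = (P.est tN z c').1 ∧
        boolPair (boolPair z c) c' ∈ SM) ∧
    ∀ k, (boolPair (boolPair z c) c' ∈ P.Dk tN k ↔ (P.est tN z c).2.1 % 8 = ((P.est tN z c').2.1 + k) % 8) := by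
  obtain ⟨ha, ha'⟩ := argE_boolPair tN z c c'
  constructor
  · unfold Cond
    rw [StockMachine.memL_setOf]
    simp only [Function.comp_apply, ha, ha', AcWalk.pvldT_apply, AcWalk.plabF_apply, List.cons.injEq, and_true, pst_eq_est]
    constructor
    · rintro ⟨h1, h2, h3, h4⟩; exact ⟨h1, h2, List.ofFn_injective h3, h4⟩
    · rintro ⟨h1, h2, h3, h4⟩; exact ⟨h1, h2, by rw [h3], h4⟩
  · intro k
    unfold Dk
    rw [StockMachine.memL_setOf]
    simp only [Function.comp_apply, ha, ha', AcWalk.pphkF_apply, Nat.add_zero, pst_eq_est]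
    constructor
    · intro h
      have h' := congrArg List.length h
      rwa [length_ones_eq, length_ones_eq] at h'
    · intro h; rw [h]

/-- The pair terms on the intended arguments are `pairTermA/B S`, given that `SM` decides `S` on the
end label. [cite: AdlemanDeMarraisHuang1997, §6 Lemma 6.10] -/
theorem termA_eq_pairTermA (z : List Bool) (S : Set (QReg (P.nq (fstP (fstP z)))))
    (hSM : ∀ c c' : List Bool, boolPair (boolPair z c) c' ∈ SM ↔ (P.est tN z c).1 ∈ S) (c c' : List Bool) :
    P.termA tN SM (boolPair (boolPair z c) c') = pairTermA S (P.est tN z c) (P.est tN z c') ∧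
    P.termB tN SM (boolPair (boolPair z c) c') = pairTermB S (P.est tN z c) (P.est tN z c') := by
  obtain ⟨hc, hD⟩ := P.mem_cond_Dk_iff tN SM z c c'
  have hind : ∀ k, ind (P.Cond tN SM ⊓ P.Dk tN k) (boolPair (boolPair z c) c') =
      if ((P.est tN z c).2.2 = true ∧ (P.est tN z c').2.2 = true ∧ (P.est tN z c).1 = (P.est tN z c').1 ∧ (P.est tN z c).1 ∈ S) ∧
        (P.est tN z c).2.1 % 8 = ((P.est tN z c').2.1 + k) % 8 then 1 else 0 := by
    intro k
    unfold ind
    have e : boolPair (boolPair z c) c' ∈ P.Cond tN SM ⊓ P.Dk tN k ↔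
        ((P.est tN z c).2.2 = true ∧ (P.est tN z c').2.2 = true ∧ (P.est tN z c).1 = (P.est tN z c').1 ∧ (P.est tN z c).1 ∈ S) ∧
          (P.est tN z c).2.1 % 8 = ((P.est tN z c').2.1 + k) % 8 := by
      rw [StockMachine.memL_inf, hc, hD k, hSM]
    by_cases h : ((P.est tN z c).2.2 = true ∧ (P.est tN z c').2.2 = true ∧ (P.est tN z c).1 = (P.est tN z c').1 ∧ (P.est tN z c).1 ∈ S) ∧
        (P.est tN z c).2.1 % 8 = ((P.est tN z c').2.1 + k) % 8
    · rw [if_pos (e.2 h), if_pos h]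
    · rw [if_neg (fun h' => h (e.1 h')), if_neg h]
  have hd : ∀ k, k < 8 → ((P.est tN z c).2.1 % 8 = ((P.est tN z c').2.1 + k) % 8 ↔
      ((P.est tN z c).2.1 + 7 * (P.est tN z c').2.1) % 8 = k) := fun k hk => by omega
  have hlt : ((P.est tN z c).2.1 + 7 * (P.est tN z c').2.1) % 8 < 8 := Nat.mod_lt _ (by norm_num)
  unfold termA termB pairTermA pairTermB
  simp only [hind, hd 0 (by norm_num), hd 4 (by norm_num), hd 1 (by norm_num), hd 7 (by norm_num), hd 3 (by norm_num), hd 5 (by norm_num)]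
  generalize ((P.est tN z c).2.1 + 7 * (P.est tN z c').2.1) % 8 = d at hlt ⊢
  by_cases hg : (P.est tN z c).2.2 = true ∧ (P.est tN z c').2.2 = true ∧ (P.est tN z c).1 = (P.est tN z c').1 ∧ (P.est tN z c).1 ∈ S
  · simp only [ite_and, if_pos hg]
    interval_cases d <;> simp [reA, reB]
  · simp [ite_and, if_neg hg]

/-- `ConsG` only reads the coins it consumes. [folklore] -/
theorem consG_congr {N : ℕ} (gas : List (AnnGate N)) (cs cs' : List Bool) (w : QReg N)
    (h : ∀ t < gas.length, cs.getD t false = cs'.getD t false) : ConsG gas cs w ↔ ConsG gas cs' w := by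
  rw [consG_iff_forall, consG_iff_forall]
  have hrun : ∀ t < gas.length, (tRunO ((gas.map Prod.fst).take t) cs (w, 0, true)).1 = (tRunO ((gas.map Prod.fst).take t) cs' (w, 0, true)).1 :=
    fun t ht => by rw [tRunO_congr _ cs cs' _ (fun u hu => h u (lt_of_lt_of_le hu (by simp)))]
  constructor
  · intro hC t k e A hg
    have ht : t < gas.length := (List.getElem?_eq_some_iff.1 hg).1
    rw [← h t ht, ← hrun t ht]; exact hC t k e A hg
  · intro hC t k e A hg
    have ht : t < gas.length := (List.getElem?_eq_some_iff.1 hg).1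
    rw [h t ht, hrun t ht]; exact hC t k e A hg

/-- Appending zeros does not change the bits read. [folklore] -/
theorem getD_append_replicate_false (l : List Bool) (d t : ℕ) : (l ++ List.replicate d false).getD t false = l.getD t false := by
  rw [List.getD_eq_getElem?_getD, List.getD_eq_getElem?_getD]
  by_cases ht : t < l.length
  · rw [List.getElem?_append_left ht]
  · rw [List.getElem?_append_right (not_lt.1 ht), List.getElem?_eq_none (not_lt.1 ht), List.getElem?_replicate]
    split_ifs <;> rfl

/-- **The values of the pair counts**: for an instance `z` whose round count `n = |tN z|` is within the
quantifier bound, and a test `SM` deciding membership of the end label of the first walk in `S`,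
`AZ z` and `BZ z` are the pair counts `annSetA/annSetB` of `annTab (tabsOf x₀ r h) (gates ↾ n)` from
`w0 x₀` on `S`. [cite: AaronsonChen2017, §5.3 (p. 23, "all the computations can be done in PSPACE")] [cite: AdlemanDeMarraisHuang1997, §6 Lemma 6.10] -/
theorem AZ_BZ_apply (z : List Bool) (S : Set (QReg (P.nq (fstP (fstP z)))))
    (hb : (tN z).length ≤ z.length + P.pF.eval z.length)
    (hSM : ∀ c c' : List Bool, boolPair (boolPair z c) c' ∈ SM ↔ (P.est tN z c).1 ∈ S) :
    P.AZ tN SM z = annSetA (AcSim.annTab (P.tabsOf (fstP (fstP z)) (sndP (fstP z)) (fstP (sndP z))) ((P.gates (fstP (fstP z))).take (tN z).length))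
      (P.w0 (fstP (fstP z))) S ∧
    P.BZ tN SM z = annSetB (AcSim.annTab (P.tabsOf (fstP (fstP z)) (sndP (fstP z)) (fstP (sndP z))) ((P.gates (fstP (fstP z))).take (tN z).length))
      (P.w0 (fstP (fstP z))) S := by
  set gas := AcSim.annTab (P.tabsOf (fstP (fstP z)) (sndP (fstP z)) (fstP (sndP z))) ((P.gates (fstP (fstP z))).take (tN z).length)
    with hgas
  have hmap : gas.map Prod.fst = (P.gates (fstP (fstP z))).take (tN z).length := AcSim.map_fst_annTab _ _
  have hmlen : ((P.gates (fstP (fstP z))).take (tN z).length).length = gas.length := by rw [← hmap, List.length_map]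
  have hmle : gas.length ≤ (tN z).length := by rw [← hmlen, List.length_take]; exact min_le_left _ _
  -- rounds bounded for every coin string
  have hRB : ∀ c : List Bool, P.RoundsBounded tN z c := fun c => by
    unfold RoundsBounded
    have h1 : z.length ≤ (boolPair z c).length := by rw [length_boolPair]; omega
    have h2 := TM2Iter.eval_mono P.pF h1
    omega
  -- the zero-tail condition of `mem_ConsLang_iff` is the tail past `|gas|`
  have hzt : ∀ c : List Bool, ((∀ t, (P.gates (fstP (fstP z))).length ≤ t → t < (tN z).length → c.getD t false = false) ↔
      (∀ t, gas.length ≤ t → t < (tN z).length → c.getD t false = false)) := by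
    intro c
    have hm' : gas.length = min (tN z).length (P.gates (fstP (fstP z))).length := by rw [← hmlen, List.length_take]
    constructor
    · intro h t hmt htn; exact h t (by rw [hm'] at hmt; omega) htn
    · intro h t hμt htn; exact h t (by rw [hm']; omega) htn
  -- the summand
  have hmem : ∀ c c' : List Bool, boolPair (boolPair z c) c' ∈ P.ConsPair tN ↔
      (ConsG gas c (P.w0 (fstP (fstP z))) ∧ ∀ t, gas.length ≤ t → t < (tN z).length → c.getD t false = false) ∧
        (ConsG gas c' (P.w0 (fstP (fstP z))) ∧ ∀ t, gas.length ≤ t → t < (tN z).length → c'.getD t false = false) := by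
    intro c c'
    unfold ConsPair
    rw [StockMachine.memL_inf, memL_preimage, memL_preimage, fstP_boolPair, pairFn_apply]
    simp only [Function.comp_apply, fstP_boolPair, sndP_boolPair]
    rw [mem_ConsLang_iff z c (hRB c), mem_ConsLang_iff z c' (hRB c'), ← hgas, hzt c, hzt c']
  have hG : ∀ c c' : List Bool,
      (P.GA tN SM (boolPair (boolPair z c) c') =
        if (ConsG gas c (P.w0 (fstP (fstP z))) ∧ ∀ t, gas.length ≤ t → t < (tN z).length → c.getD t false = false) ∧
            (ConsG gas c' (P.w0 (fstP (fstP z))) ∧ ∀ t, gas.length ≤ t → t < (tN z).length → c'.getD t false = false)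
        then pairTermA S (P.est tN z c) (P.est tN z c') else 0) ∧
      (P.GB tN SM (boolPair (boolPair z c) c') =
        if (ConsG gas c (P.w0 (fstP (fstP z))) ∧ ∀ t, gas.length ≤ t → t < (tN z).length → c.getD t false = false) ∧
            (ConsG gas c' (P.w0 (fstP (fstP z))) ∧ ∀ t, gas.length ≤ t → t < (tN z).length → c'.getD t false = false)
        then pairTermB S (P.est tN z c) (P.est tN z c') else 0) := by
    intro c c'
    obtain ⟨hA, hB⟩ := P.termA_eq_pairTermA tN SM z S hSM c c'
    unfold GA GB
    rw [hA, hB]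
    by_cases h : boolPair (boolPair z c) c' ∈ P.ConsPair tN
    · rw [if_pos h, if_pos h, if_pos ((hmem c c').1 h), if_pos ((hmem c c').1 h)]; exact ⟨rfl, rfl⟩
    · rw [if_neg h, if_neg h, if_neg (fun h' => h ((hmem c c').2 h')), if_neg (fun h' => h ((hmem c c').2 h'))]; exact ⟨rfl, rfl⟩
  -- dependence on the first `|gas|` coins only
  have hest : ∀ c : List Bool, P.est tN z (c ++ List.replicate ((tN z).length - gas.length) false) = P.est tN z c := fun c =>
    tRunO_congr _ _ _ _ fun t _ => getD_append_replicate_false c _ t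
  have hcons : ∀ c : List Bool, ConsG gas (c ++ List.replicate ((tN z).length - gas.length) false) (P.w0 (fstP (fstP z))) ↔
      ConsG gas c (P.w0 (fstP (fstP z))) := fun c =>
    consG_congr gas _ _ _ fun t _ => getD_append_replicate_false c _ t
  -- the generic computation, for a pair term `T` and summand `G`
  have key : ∀ (G : List Bool → ℤ) (T : TState (P.nq (fstP (fstP z))) → TState (P.nq (fstP (fstP z))) → ℤ),
      (∀ c c' : List Bool, G (boolPair (boolPair z c) c') =
        if (ConsG gas c (P.w0 (fstP (fstP z))) ∧ ∀ t, gas.length ≤ t → t < (tN z).length → c.getD t false = false) ∧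
            (ConsG gas c' (P.w0 (fstP (fstP z))) ∧ ∀ t, gas.length ≤ t → t < (tN z).length → c'.getD t false = false)
        then T (P.est tN z c) (P.est tN z c') else 0) →
      (∑ c : List.Vector Bool (tN z).length, ∑ c' : List.Vector Bool (tN (fstP (boolPair z c.toList))).length,
          G (boolPair (boolPair z c.toList) c'.toList)) =
        ∑ b : Fin gas.length → Bool, ∑ b' : Fin gas.length → Bool,
          if ConsG gas (List.ofFn b) (P.w0 (fstP (fstP z))) ∧ ConsG gas (List.ofFn b') (P.w0 (fstP (fstP z))) then
            T (tRunO (gas.map Prod.fst) (List.ofFn b) (P.w0 (fstP (fstP z)), 0, true))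
              (tRunO (gas.map Prod.fst) (List.ofFn b') (P.w0 (fstP (fstP z)), 0, true))
          else 0 := by
    intro G T hGv
    -- inner index: `tN (fstP ⟨z, c⟩) = tN z`
    have hidx : ∀ c : List.Vector Bool (tN z).length,
        (∑ c' : List.Vector Bool (tN (fstP (boolPair z c.toList))).length, G (boolPair (boolPair z c.toList) c'.toList)) =
          ∑ c' : List.Vector Bool (tN z).length, G (boolPair (boolPair z c.toList) c'.toList) := fun c =>
      sum_vector_congr_len (by rw [fstP_boolPair]) fun l => G (boolPair (boolPair z c.toList) l)
    simp_rw [hidx]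
    -- collapse of the inner tail
    have hinner : ∀ c : List.Vector Bool (tN z).length,
        (∑ c' : List.Vector Bool (tN z).length, G (boolPair (boolPair z c.toList) c'.toList)) =
          ∑ c₁' : List.Vector Bool gas.length,
            (if (ConsG gas c.toList (P.w0 (fstP (fstP z))) ∧ ∀ t, gas.length ≤ t → t < (tN z).length → c.toList.getD t false = false) ∧
                ConsG gas c₁'.toList (P.w0 (fstP (fstP z)))
             then T (P.est tN z c.toList) (P.est tN z c₁'.toList) else 0) := by
      intro c
      show (∑ c' : List.Vector Bool (tN z).length, (fun l => G (boolPair (boolPair z c.toList) l)) c'.toList) = _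
      refine (sum_vector_zeroTail' hmle (fun l => G (boolPair (boolPair z c.toList) l))
        (fun l => if (ConsG gas c.toList (P.w0 (fstP (fstP z))) ∧ ∀ t, gas.length ≤ t → t < (tN z).length → c.toList.getD t false = false) ∧
            ConsG gas l (P.w0 (fstP (fstP z))) then T (P.est tN z c.toList) (P.est tN z l) else 0) fun l _ => ?_).trans ?_
      · rw [hGv c.toList l]
        by_cases hzc : ∀ t, gas.length ≤ t → t < (tN z).length → l.getD t false = false
        · rw [if_pos hzc]
          simp only [ite_and, if_pos hzc]
        · rw [if_neg hzc, if_neg (fun h => hzc h.2.2)]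
      · refine Finset.sum_congr rfl fun c₁' _ => ?_
        rw [hcons c₁'.toList, hest c₁'.toList]
    simp_rw [hinner]
    -- collapse of the outer tail
    show (∑ c : List.Vector Bool (tN z).length, (fun l => ∑ c₁' : List.Vector Bool gas.length,
        (if (ConsG gas l (P.w0 (fstP (fstP z))) ∧ ∀ t, gas.length ≤ t → t < (tN z).length → l.getD t false = false) ∧
            ConsG gas c₁'.toList (P.w0 (fstP (fstP z))) then T (P.est tN z l) (P.est tN z c₁'.toList) else 0)) c.toList) = _
    refine (sum_vector_zeroTail' hmle (fun l => ∑ c₁' : List.Vector Bool gas.length,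
        (if (ConsG gas l (P.w0 (fstP (fstP z))) ∧ ∀ t, gas.length ≤ t → t < (tN z).length → l.getD t false = false) ∧
            ConsG gas c₁'.toList (P.w0 (fstP (fstP z))) then T (P.est tN z l) (P.est tN z c₁'.toList) else 0))
      (fun l => ∑ c₁' : List.Vector Bool gas.length, (if ConsG gas l (P.w0 (fstP (fstP z))) ∧ ConsG gas c₁'.toList (P.w0 (fstP (fstP z))) then
        T (P.est tN z l) (P.est tN z c₁'.toList) else 0)) fun l _ => ?_).trans ?_
    · by_cases hzc : ∀ t, gas.length ≤ t → t < (tN z).length → l.getD t false = false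
      · rw [if_pos hzc]
        refine Finset.sum_congr rfl fun c₁' _ => ?_
        simp only [ite_and, if_pos hzc]
      · rw [if_neg hzc]; exact Finset.sum_eq_zero fun c₁' _ => if_neg (fun h => hzc h.1.2)
    rw [show (∑ c₁ : List.Vector Bool gas.length, (fun l => ∑ c₁' : List.Vector Bool gas.length,
        (if ConsG gas l (P.w0 (fstP (fstP z))) ∧ ConsG gas c₁'.toList (P.w0 (fstP (fstP z))) then T (P.est tN z l) (P.est tN z c₁'.toList) else 0))
          (c₁.toList ++ List.replicate ((tN z).length - gas.length) false)) =
        ∑ c₁ : List.Vector Bool gas.length, ∑ c₁' : List.Vector Bool gas.length,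
          (if ConsG gas c₁.toList (P.w0 (fstP (fstP z))) ∧ ConsG gas c₁'.toList (P.w0 (fstP (fstP z))) then
            T (P.est tN z c₁.toList) (P.est tN z c₁'.toList) else 0) from
      Finset.sum_congr rfl fun c₁ _ => by dsimp only; rw [hcons c₁.toList, hest c₁.toList]]
    -- to `Fin |gas| → Bool`
    rw [sum_vector_eq_sum_fin gas.length fun l => ∑ c₁' : List.Vector Bool gas.length,
      if ConsG gas l (P.w0 (fstP (fstP z))) ∧ ConsG gas c₁'.toList (P.w0 (fstP (fstP z))) then T (P.est tN z l) (P.est tN z c₁'.toList) else 0]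
    refine Finset.sum_congr rfl fun b _ => ?_
    rw [sum_vector_eq_sum_fin gas.length fun l => if ConsG gas (List.ofFn b) (P.w0 (fstP (fstP z))) ∧ ConsG gas l (P.w0 (fstP (fstP z))) then
      T (P.est tN z (List.ofFn b)) (P.est tN z l) else 0]
    refine Finset.sum_congr rfl fun b' _ => ?_
    rw [hmap]
  constructor
  · unfold AZ innerA
    rw [annSetA_eq_sum_consG]
    exact key _ _ fun c c' => (hG c c').1
  · unfold BZ innerB
    rw [annSetB_eq_sum_consG]
    exact key _ _ fun c c' => (hG c c').2

end Pairs

end AcProto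

end Literature.Barriers.QuantumAdvantage

end

/-! ## Part 4 (`AaronsonChenPhysicsPSPACE`): Aaronson–Chen 2017, Lemma 5.3: the two physical predicates of the simulator are in `PSPACE`

Conclusion of the machine-level line `AaronsonChenTabLang.lean` → `AaronsonChenWalkAtoms.lean` →
`AaronsonChenPairSums.lean` for the printed sentence "it is not hard to see that all the computations
can be done in `PSPACE`" ([AaronsonChen2017, §5.3 p. 23]) in the form the assembly of Lemma 5.3
consumes (`AaronsonChenAdvicePSPACE.lean`: `aaronsonChen2017_lem53_of_physics`): for protocol data
with a UNIFORM circuit family and bounding polynomials, the heavy/small-table predicate `HeavyLang`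
and the cumulative-distribution predicate `CdfLang` of `AaronsonChenAdvice.lean` are in `PSPACE`.
By `AaronsonChenAdviceWeights.lean` both are exact `√2`-sign tests `posSqrtTwoTest` on integer
combinations of the pair counts, the Hadamard power and the budget; by `AaronsonChenPairSums.lean`
these integers are `GapNatPSPACE` functions of the instance; and the sign test of two gap functions is
a Boolean combination of positivity tests (`GapNatPSpace.pos_mem_PSPACE`):

* `posSqrtTwo_mem_PSPACE` — `{x | posSqrtTwoTest (a x) (b x)} ∈ PSPACE` for `a, b ∈ GapNatPSPACE`;
  `linFormTest_eq_posSqrtTwoTest` (the one-set linear form);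
* the heavy case: round count `tNH = ν`, the cylinder test `SMH` ("the query register of the end
  label spells `1u`", `qryF`), the gap functions `aH`, `bH`, the guard atoms, and
  **`HeavyLang_mem_PSPACE`**;
* the sampling case: round count `tNC = 1^{pF(|x₀|)}` (all gates), the order test `SMC`
  ("`⟦end label⟧ ≤ ⟦Y⟧`"), `aC`, `bC`, and **`CdfLang_mem_PSPACE`**;
* **`physics_mem_PSPACE`** — the hypothesis of `aaronsonChen2017_lem53_of_physics`, discharged.

No named facts.

## References

* [AaronsonChen2017] arXiv:1612.05903, Lemma 5.3, §5.3 (pp. 22–23), read via `lit read arxiv:1612.05903 --pages 19-25`.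
* [AdlemanDeMarraisHuang1997] §6, Lemma 6.10; [FennerFortnowKurtz1994] §3, Prop. 4.2; [Ladner1989] §1.
-/

noncomputable section

namespace Literature.Barriers.QuantumAdvantage

open MeasureTheory _root_.Computability Polynomial Literature.Computability.Complexity
  Literature.Computability.Complexity.Brick Literature.Computability.Complexity.Plumb
  Literature.Computability.Complexity.OracleCompose Literature.Computability.Complexity.PRelSigma
  Literature.Computability.Complexity.TTClosure Literature.Computability.Complexity.StrEq
  Literature.Computability.Cryptography Literature.Computability.QuantumComplexity
  Literature.Computability.QuantumComplexity.ADH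
open scoped Classical

attribute [-simp] Brick.nthF_zero Brick.sndPow_zero

/-! ### The exact `√2`-sign test of two gap functions -/

/-- **The sign test `0 < a + b√2` of two `GapNatPSPACE` functions is a `PSPACE` predicate**: it is the
Boolean combination `(0 < a ∧ (0 ≤ b ∨ 2b² < a²)) ∨ (a ≤ 0 ∧ 0 ≤ b ∧ a² < 2b²)` of sign conditions of
gap functions (`pos_mem_PSPACE` and the ring closure). [cite: FennerFortnowKurtz1994, Proposition 4.2] [cite: AdlemanDeMarraisHuang1997, §6 Lemma 6.10 (exact comparison of the two parts)] -/
theorem posSqrtTwo_mem_PSPACE {a b : List Bool → ℤ} (ha : a ∈ GapNatPSPACE) (hb : b ∈ GapNatPSPACE) :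
    ({x | posSqrtTwoTest (a x) (b x) = true} : Language Bool) ∈ PSPACE := by
  obtain ⟨B, hB⟩ := exists_isComplete_PSPACE_holds
  have h2bb : (fun x => 2 * b x * b x) ∈ GapNatPSPACE := mul_mem_GapNatPSPACE (zsmul_mem_GapNatPSPACE 2 hb) hb
  have haa : (fun x => a x * a x) ∈ GapNatPSPACE := mul_mem_GapNatPSPACE ha ha
  have h := setOf_or_mem_PSPACE_of_complete hB
    (setOf_and_mem_PSPACE_of_complete hB (pos_mem_PSPACE ha)
      (setOf_or_mem_PSPACE_of_complete hB (nonneg_mem_PSPACE hb) (setOf_lt_mem_PSPACE h2bb haa)))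
    (setOf_and_mem_PSPACE_of_complete hB (nonpos_mem_PSPACE ha)
      (setOf_and_mem_PSPACE_of_complete hB (nonneg_mem_PSPACE hb) (setOf_lt_mem_PSPACE haa h2bb)))
  refine mem_PSPACE_of_iff' h _ fun x => ?_
  change posSqrtTwoTest (a x) (b x) = true ↔ (0 < a x ∧ (0 ≤ b x ∨ 2 * b x * b x < a x * a x)) ∨ (a x ≤ 0 ∧ 0 ≤ b x ∧ a x * a x < 2 * b x * b x)
  simp [posSqrtTwoTest]

/-- The one-set linear form: `linFormTest c₀ c₁ 0 A B 0 0 = posSqrtTwoTest (2(c₁A + c₀)) (c₁B)`. [folklore] -/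
theorem linFormTest_eq_posSqrtTwoTest (c₀ c₁ A B : ℤ) :
    linFormTest c₀ c₁ 0 A B 0 0 = posSqrtTwoTest (2 * (c₁ * A + c₀)) (c₁ * B) := by
  unfold linFormTest
  congr 1 <;> ring

namespace AcProto

variable (P : AcProto)

/-! ### The heavy/small-table predicate -/

section Heavy

/-- The stage numeral `ν` of a heavy instance `z = ⟨w, ⟨h, ⟨ν, u⟩⟩⟩` (the walk has `|ν|` gates). [folklore] -/
def tNH (z : List Bool) : List Bool := fstP (sndP (sndP z))
/-- The query tail `u` of a heavy instance. [folklore] -/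
def uH (z : List Bool) : List Bool := sndP (sndP (sndP z))

/-- `tNH ∈ FP`. [folklore] -/
theorem tNH_mem_FP : tNH ∈ FP := comp_mem_FP fstP_mem_FP (comp_mem_FP sndP_mem_FP sndP_mem_FP)
/-- `uH ∈ FP`. [folklore] -/
theorem uH_mem_FP : uH ∈ FP := comp_mem_FP sndP_mem_FP (comp_mem_FP sndP_mem_FP sndP_mem_FP)

/-- **The cylinder test**: the query register of the end label of the first walk spells `1u`. [cite: AaronsonChen2017, §5.3 (p. 22, "Q(x) ≥ τ")] -/
def SMH : Language Bool := {y | (qryF P.F ∘ argE tNH) y = (List.cons true ∘ uH ∘ zW) y}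

/-- The `a`-argument of the heavy sign test: `2(−a·A_S + 2^h)`. [cite: AaronsonChen2017, §5.3 (p. 22)] -/
def aH (z : List Bool) : ℤ := 2 * (-P.budZ z * P.AZ tNH P.SMH z + (P.HZ tNH z : ℤ))
/-- The `b`-argument of the heavy sign test: `−a·B_S`. [cite: AaronsonChen2017, §5.3 (p. 22)] -/
def bH (z : List Bool) : ℤ := -P.budZ z * P.BZ tNH P.SMH z

/-- The guard argument `⟨x₀, ⟨ε, bin |ν|⟩⟩` (gate `|ν|`, no coins). [folklore] -/
def argH : List Bool → List Bool := pairFn x0Z (pairFn (fun _ => []) (lenBinF ∘ tNH))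

variable {P}

/-- The heavy gap functions are gap functions (uniform family). [cite: FennerFortnowKurtz1994, §3] -/
theorem aH_bH_mem (hU : P.F.IsUniform) : P.aH ∈ GapNatPSPACE ∧ P.bH ∈ GapNatPSPACE := by
  obtain ⟨-, -, -, -, -, -, -, -, hq, -⟩ := atoms_mem_FP hU
  have htN : tNH ∈ FP := tNH_mem_FP
  have hSM : P.SMH ∈ Classes.P :=
    setOf_apply_eq_apply_mem_P (comp_mem_FP hq (argE_mem_FP tNH htN).1)
      (comp_mem_FP (cons_mem_FP true) (comp_mem_FP uH_mem_FP (comp_mem_FP fstP_mem_FP fstP_mem_FP)))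
  obtain ⟨hA, hB⟩ := P.AZ_BZ_mem tNH hU htN hSM
  have hbud := budZ_mem hU
  have hnb : (fun z => -P.budZ z) ∈ GapNatPSPACE := neg_mem_GapNatPSPACE hbud
  refine ⟨?_, mul_mem_GapNatPSPACE hnb hB⟩
  exact zsmul_mem_GapNatPSPACE 2 (add_mem_GapNatPSPACE (mul_mem_GapNatPSPACE hnb hA) (natPSPACE_mem_GapNatPSPACE (HZ_mem hU htN)))

/-- **`HeavyLang ∈ PSPACE`** for protocol data with a uniform family and bounding polynomials.
[cite: AaronsonChen2017, §5.3 (p. 22, "Construction and Analysis of g"; p. 23, "all the computations can be done in PSPACE")] -/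
theorem HeavyLang_mem_PSPACE (hU : P.F.IsUniform) (hP : P.IsBounded) : P.HeavyLang ∈ PSPACE := by
  obtain ⟨B, hB⟩ := exists_isComplete_PSPACE_holds
  obtain ⟨-, -, -, -, -, horc, -, -, hq, -⟩ := atoms_mem_FP hU
  obtain ⟨ha, hb⟩ := aH_bH_mem hU
  have hargH : argH ∈ FP := pairFn_mem_FP (comp_mem_FP fstP_mem_FP fstP_mem_FP)
    (pairFn_mem_FP (const_mem_FP _) (comp_mem_FP lenBinF_mem_FP tNH_mem_FP))
  have hargH_apply : ∀ z, argH z = boolPair (fstP (fstP z)) (boolPair [] (encodeNat (tNH z).length)) := fun z => by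
    simp [argH]
  -- the guard atoms: gate `|ν|` is a query gate with `|u| + 1` query wires
  have hO : ({z | (orcT P.F ∘ argH) z = [true]} : Language Bool) ∈ Classes.P :=
    setOf_apply_eq_apply_mem_P (comp_mem_FP horc hargH) (const_mem_FP _)
  have hK : ({z | (onesFn ∘ qryF P.F ∘ argH) z = (onesFn ∘ List.cons true ∘ uH) z} : Language Bool) ∈ Classes.P :=
    setOf_apply_eq_apply_mem_P (comp_mem_FP onesFn_mem_FP (comp_mem_FP hq hargH))
      (comp_mem_FP onesFn_mem_FP (comp_mem_FP (cons_mem_FP true) uH_mem_FP))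
  -- the budget comparison `2^{|u|} ≤ a`
  have hpow : (fun z => (2 : ℤ) ^ (uH z).length) ∈ GapNatPSPACE := two_pow_length_mem_GapNatPSPACE uH_mem_FP
  have hbud := budZ_mem hU
  have hsmall : ({z | (2 : ℤ) ^ (uH z).length ≤ P.budZ z} : Language Bool) ∈ PSPACE := by
    refine mem_PSPACE_of_iff' (nonneg_mem_PSPACE (sub_mem_GapNatPSPACE hbud hpow)) _ fun z => ?_
    change (2 : ℤ) ^ (uH z).length ≤ P.budZ z ↔ 0 ≤ P.budZ z - 2 ^ (uH z).length
    omega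
  have htest : ({z | posSqrtTwoTest (P.aH z) (P.bH z) = true} : Language Bool) ∈ PSPACE := posSqrtTwo_mem_PSPACE ha hb
  have h := inter_P_mem_PSPACE hO (inter_P_mem_PSPACE hK
    (union_mem_PSPACE_of_complete hB hsmall (inter_mem_PSPACE_of_complete hB (compl_mem_PSPACE hsmall) (compl_mem_PSPACE htest))))
  refine mem_PSPACE_of_iff' h _ fun z => ?_
  rw [StockMachine.memL_inf, StockMachine.memL_inf, StockMachine.memL_sup, StockMachine.memL_inf, PPSharpP.memL_compl,
    PPSharpP.memL_compl, StockMachine.memL_setOf, StockMachine.memL_setOf, StockMachine.memL_setOf, StockMachine.memL_setOf]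
  -- the printed characterisation
  have key := P.mem_stageList_iff_linFormTest (fstP (fstP z)) (P.tabsOf (fstP (fstP z)) (sndP (fstP z)) (fstP (sndP z)))
    (tNH z).length (uH z)
  change uH z ∈ P.stageList (fstP (fstP z)) (P.tabsOf (fstP (fstP z)) (sndP (fstP z)) (fstP (sndP z))) (tNH z).length ↔ _
  rw [key]
  simp only [Function.comp_apply, hargH_apply, onesFn_apply, List.length_cons]
  -- atoms
  have horc' : orcT P.F (boolPair (fstP (fstP z)) (boolPair [] (encodeNat (tNH z).length))) = [true] ↔
      ∃ k e, (P.gates (fstP (fstP z)))[(tNH z).length]? = some (.oracle k e) := by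
    rw [orcT_apply]
    change [(((P.gates (fstP (fstP z)))[(tNH z).length]?).map isOracleB).getD false] = [true] ↔ _
    cases hg : (P.gates (fstP (fstP z)))[(tNH z).length]? with
    | none => simp
    | some g =>
      cases g with
      | gate op e => simp [isOracleB]
      | oracle k e => exact ⟨fun _ => ⟨k, e, rfl⟩, fun _ => rfl⟩
  have hbudv : P.budZ z = (P.bud (fstP (fstP z)) : ℤ) := budZ_apply hP z
  constructor
  · rintro ⟨k, e, hg, hlen, hcase⟩
    obtain ⟨hn, hgt⟩ := List.getElem?_eq_some_iff.1 hg
    have hq' : qryF P.F (boolPair (fstP (fstP z)) (boolPair [] (encodeNat (tNH z).length))) = queryOf e (AcWalk.pst P.F (fstP (fstP z)) [] (tNH z).length).1 :=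
      qryF_apply P.F (fstP (fstP z)) [] hn hgt
    refine ⟨horc'.2 ⟨_, e, hg⟩, by rw [hq', length_queryOf, hlen], ?_⟩
    rcases hcase with hs | ⟨hs, ht⟩
    · left; rw [hbudv, hlen]; exact_mod_cast hs
    · right
      refine ⟨by rw [hbudv, hlen]; exact_mod_cast hs, ?_⟩
      -- the sign test
      have hSM : ∀ c c' : List Bool, boolPair (boolPair z c) c' ∈ P.SMH ↔ (P.est tNH z c).1 ∈ {x | queryOf e x = true :: uH z} := by
        intro c c'
        unfold SMH
        rw [StockMachine.memL_setOf]
        simp only [Function.comp_apply, (argE_boolPair tNH z c c').1, qryF_apply P.F (fstP (fstP z)) c hn hgt, fstP_boolPair]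
        exact Iff.rfl
      have hbnd : (tNH z).length ≤ z.length + P.pF.eval z.length := by
        have h1 := length_boolUnpair_parts_le z
        have h2 := length_boolUnpair_parts_le (sndP z)
        have h3 := length_boolUnpair_parts_le (sndP (sndP z))
        unfold tNH
        change 2 * (fstP z).length + (sndP z).length ≤ _ at h1
        change 2 * (fstP (sndP z)).length + (sndP (sndP z)).length ≤ _ at h2
        change 2 * (fstP (sndP (sndP z))).length + (sndP (sndP (sndP z))).length ≤ _ at h3
        omega
      obtain ⟨hA, hBz⟩ := P.AZ_BZ_apply tNH P.SMH z {x | queryOf e x = true :: uH z} hbnd hSM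
      have e2 : (P.HZ tNH z : ℤ) = (2 : ℤ) ^ hCount ((P.gates (fstP (fstP z))).take (tNH z).length) := by
        rw [HZ_apply]; push_cast; rfl
      rw [linFormTest_eq_posSqrtTwoTest] at ht
      unfold aH bH
      rw [hA, hBz, e2, hbudv, ht]
      exact Bool.false_ne_true
  · rintro ⟨ho, hlen, hcase⟩
    obtain ⟨k, e, hg⟩ := horc'.1 ho
    obtain ⟨hn, hgt⟩ := List.getElem?_eq_some_iff.1 hg
    have hq' : qryF P.F (boolPair (fstP (fstP z)) (boolPair [] (encodeNat (tNH z).length))) = queryOf e (AcWalk.pst P.F (fstP (fstP z)) [] (tNH z).length).1 :=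
      qryF_apply P.F (fstP (fstP z)) [] hn hgt
    rw [hq', length_queryOf] at hlen
    have hk : k = (uH z).length + 1 := by simpa using congrArg List.length hlen
    subst hk
    refine ⟨(uH z).length, e, hg, rfl, ?_⟩
    rcases hcase with hs | ⟨hs, ht⟩
    · left; rw [hbudv] at hs; exact_mod_cast hs
    · right
      refine ⟨by rw [hbudv] at hs; exact_mod_cast hs, ?_⟩
      have hSM : ∀ c c' : List Bool, boolPair (boolPair z c) c' ∈ P.SMH ↔ (P.est tNH z c).1 ∈ {x | queryOf e x = true :: uH z} := by
        intro c c'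
        unfold SMH
        rw [StockMachine.memL_setOf]
        simp only [Function.comp_apply, (argE_boolPair tNH z c c').1, qryF_apply P.F (fstP (fstP z)) c hn hgt, fstP_boolPair]
        exact Iff.rfl
      have hbnd : (tNH z).length ≤ z.length + P.pF.eval z.length := by
        have h1 := length_boolUnpair_parts_le z
        have h2 := length_boolUnpair_parts_le (sndP z)
        have h3 := length_boolUnpair_parts_le (sndP (sndP z))
        unfold tNH
        change 2 * (fstP z).length + (sndP z).length ≤ _ at h1
        change 2 * (fstP (sndP z)).length + (sndP (sndP z)).length ≤ _ at h2
        change 2 * (fstP (sndP (sndP z))).length + (sndP (sndP (sndP z))).length ≤ _ at h3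
        omega
      obtain ⟨hA, hBz⟩ := P.AZ_BZ_apply tNH P.SMH z {x | queryOf e x = true :: uH z} hbnd hSM
      have e2 : (P.HZ tNH z : ℤ) = (2 : ℤ) ^ hCount ((P.gates (fstP (fstP z))).take (tNH z).length) := by
        rw [HZ_apply]; push_cast; rfl
      rw [linFormTest_eq_posSqrtTwoTest, Bool.eq_false_iff]
      intro h'
      apply ht
      unfold aH bH
      rw [hA, hBz, e2, hbudv]
      exact h'

end Heavy

/-! ### The cumulative-distribution predicate -/

section Cdf

/-- The round count `1^{pF(|x₀|)}` of a sampling instance (at least the number of gates). [folklore] -/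
def tNC : List Bool → List Bool := polyFn P.pF ∘ x0Z
/-- The sample candidate `Y` of a sampling instance `z = ⟨w, ⟨h, Y⟩⟩`. [folklore] -/
def yC (z : List Bool) : List Bool := sndP (sndP z)

/-- `yC ∈ FP`. [folklore] -/
theorem yC_mem_FP : yC ∈ FP := comp_mem_FP sndP_mem_FP sndP_mem_FP

/-- **The order test**: `⟦end label⟧ ≤ ⟦Y⟧` (not `⟦Y⟧ < ⟦end label⟧`). [cite: AaronsonChen2017, §5.3 (p. 23)] [cite: KnuthTAOCP2, §3.4.1 A] -/
def SMC : Language Bool := {y | (ltFn ∘ pairFn (yC ∘ zW) (AcWalk.plabF P.F ∘ argE P.tNC)) y = (fun _ => [false]) y}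

/-- The `a`-argument of the sampling sign test: `2(2^{|r|}·A_S − ⟦r⟧·2^h)`. [cite: AaronsonChen2017, §5.3 (p. 23)] -/
def aC (z : List Bool) : ℤ :=
  2 * ((2 : ℤ) ^ (sndP (fstP z)).length * P.AZ P.tNC P.SMC z + -((bitsToNat (sndP (fstP z)) : ℤ) * (P.HZ P.tNC z : ℤ)))
/-- The `b`-argument of the sampling sign test: `2^{|r|}·B_S`. [cite: AaronsonChen2017, §5.3 (p. 23)] -/
def bC (z : List Bool) : ℤ := (2 : ℤ) ^ (sndP (fstP z)).length * P.BZ P.tNC P.SMC z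

variable {P}

/-- `tNC ∈ FP`. [folklore] -/
theorem tNC_mem_FP : P.tNC ∈ FP := comp_mem_FP (polyFn_mem_FP _) (comp_mem_FP fstP_mem_FP fstP_mem_FP)

/-- Value of `tNC`. [folklore] -/
theorem length_tNC (z : List Bool) : (P.tNC z).length = P.pF.eval (fstP (fstP z)).length := by
  simp [tNC]

/-- The sampling gap functions are gap functions (uniform family). [cite: FennerFortnowKurtz1994, §3] -/
theorem aC_bC_mem (hU : P.F.IsUniform) : P.aC ∈ GapNatPSPACE ∧ P.bC ∈ GapNatPSPACE := by
  obtain ⟨-, hl, -⟩ := AcWalk.patoms_mem_FP hU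
  have hSM : P.SMC ∈ Classes.P :=
    setOf_apply_eq_apply_mem_P (comp_mem_FP ltFn_mem_FP (pairFn_mem_FP (comp_mem_FP yC_mem_FP
      (comp_mem_FP fstP_mem_FP fstP_mem_FP)) (comp_mem_FP hl (argE_mem_FP P.tNC tNC_mem_FP).1))) (const_mem_FP _)
  obtain ⟨hA, hB⟩ := P.AZ_BZ_mem P.tNC hU tNC_mem_FP hSM
  have hpow : (fun z => (2 : ℤ) ^ (sndP (fstP z)).length) ∈ GapNatPSPACE :=
    two_pow_length_mem_GapNatPSPACE (comp_mem_FP sndP_mem_FP fstP_mem_FP)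
  have hr : (fun z => (bitsToNat (sndP (fstP z)) : ℤ)) ∈ GapNatPSPACE := natFP_mem_GapNatPSPACE (comp_mem_FP sndP_mem_FP fstP_mem_FP)
  refine ⟨zsmul_mem_GapNatPSPACE 2 (add_mem_GapNatPSPACE (mul_mem_GapNatPSPACE hpow hA)
    (neg_mem_GapNatPSPACE (mul_mem_GapNatPSPACE hr (natPSPACE_mem_GapNatPSPACE (HZ_mem hU tNC_mem_FP))))),
    mul_mem_GapNatPSPACE hpow hB⟩

/-- **`CdfLang ∈ PSPACE`** for protocol data with a uniform family and bounding polynomials.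
[cite: AaronsonChen2017, §5.3 (p. 23, "takes a sample z by measuring |v_{T+1}⟩"; "all the computations can be done in PSPACE")] -/
theorem CdfLang_mem_PSPACE (hU : P.F.IsUniform) (hP : P.IsBounded) : P.CdfLang ∈ PSPACE := by
  obtain ⟨-, hl, -⟩ := AcWalk.patoms_mem_FP hU
  obtain ⟨ha, hb⟩ := aC_bC_mem hU
  -- the length guard `|Y| = #wires`, read off the label of the empty walk
  have harg0 : (pairFn x0Z (fun _ => boolPair [] (encodeNat 0)) : List Bool → List Bool) ∈ FP :=
    pairFn_mem_FP (comp_mem_FP fstP_mem_FP fstP_mem_FP) (const_mem_FP _)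
  have hN : ({z | (onesFn ∘ yC) z = (onesFn ∘ AcWalk.plabF P.F ∘ pairFn x0Z (fun _ => boolPair [] (encodeNat 0))) z} : Language Bool) ∈ Classes.P :=
    setOf_apply_eq_apply_mem_P (comp_mem_FP onesFn_mem_FP yC_mem_FP)
      (comp_mem_FP onesFn_mem_FP (comp_mem_FP hl harg0))
  have htest : ({z | posSqrtTwoTest (P.aC z) (P.bC z) = true} : Language Bool) ∈ PSPACE := posSqrtTwo_mem_PSPACE ha hb
  refine mem_PSPACE_of_iff' (inter_P_mem_PSPACE hN htest) _ fun z => ?_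
  rw [StockMachine.memL_inf, StockMachine.memL_setOf, StockMachine.memL_setOf]
  simp only [Function.comp_apply, pairFn_apply, onesFn_apply, AcWalk.plabF_apply, List.length_ofFn]
  change ((yC z).length = P.nq (fstP (fstP z)) ∧ P.Sel (fstP (fstP z)) (sndP (fstP z)) (fstP (sndP z)) (bitsToNat (yC z))) ↔ _
  rw [P.sel_iff_linFormTest]
  have hones : ∀ a b : ℕ, ones a = ones b ↔ a = b := fun a b =>
    ⟨fun h => by simpa using congrArg List.length h, fun h => by rw [h]⟩
  rw [hones]
  refine and_congr_right fun hlen => ?_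
  have hlt : bitsToNat (yC z) < 2 ^ P.nq (fstP (fstP z)) := hlen ▸ bitsToNat_lt _
  simp only [hlt, true_and]
  -- the identification of the sign test
  have hμ : (P.gates (fstP (fstP z))).length ≤ (P.tNC z).length := by rw [length_tNC]; exact (hP.size_le _).1
  have htake : (P.gates (fstP (fstP z))).take (P.tNC z).length = P.gates (fstP (fstP z)) := List.take_of_length_le hμ
  have hSM : ∀ c c' : List Bool, boolPair (boolPair z c) c' ∈ P.SMC ↔
      (P.est P.tNC z c).1 ∈ {y | bitsToNat (List.ofFn y) ≤ bitsToNat (yC z)} := by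
    intro c c'
    unfold SMC
    rw [StockMachine.memL_setOf]
    simp only [Function.comp_apply, pairFn_apply, (argE_boolPair P.tNC z c c').1, AcWalk.plabF_apply, ltFn_boolPair, List.cons.injEq,
      and_true, decide_eq_false_iff_not, not_lt, Set.mem_setOf_eq, fstP_boolPair]
    exact Iff.rfl
  have hbnd : (P.tNC z).length ≤ z.length + P.pF.eval z.length := by
    rw [length_tNC]
    have h1 := length_boolUnpair_parts_le z
    have h2 := length_boolUnpair_parts_le (fstP z)
    change 2 * (fstP z).length + (sndP z).length ≤ _ at h1
    change 2 * (fstP (fstP z)).length + (sndP (fstP z)).length ≤ _ at h2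
    have := TM2Iter.eval_mono P.pF (show (fstP (fstP z)).length ≤ z.length by omega)
    omega
  obtain ⟨hA, hBz⟩ := P.AZ_BZ_apply P.tNC P.SMC z {y | bitsToNat (List.ofFn y) ≤ bitsToNat (yC z)} hbnd hSM
  rw [htake] at hA hBz
  have e2 : (P.HZ P.tNC z : ℤ) = (2 : ℤ) ^ hCount (P.gates (fstP (fstP z))) := by
    rw [HZ_apply]
    change ((2 ^ hCount ((P.gates (fstP (fstP z))).take (P.tNC z).length) : ℕ) : ℤ) = _
    rw [htake]; push_cast; rfl
  rw [linFormTest_eq_posSqrtTwoTest]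
  unfold aC bC
  rw [hA, hBz, e2]

end Cdf

/-- **The physical hypothesis of `aaronsonChen2017_lem53_of_physics`, discharged**: for every protocol
with a uniform family, polynomial-time post-processing and bounding polynomials, both physical
predicates are in `PSPACE`. [cite: AaronsonChen2017, §5.3 (p. 23, "all the computations can be done in PSPACE")] -/
theorem physics_mem_PSPACE (P : AcProto) (hU : P.F.IsUniform) (_hpost : P.post ∈ FP) (hP : P.IsBounded) :
    P.HeavyLang ∈ PSPACE ∧ P.CdfLang ∈ PSPACE :=
  ⟨HeavyLang_mem_PSPACE hU hP, CdfLang_mem_PSPACE hU hP⟩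

end AcProto

end Literature.Barriers.QuantumAdvantage

end
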